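import Literature.MathematicalPhysics.QuantumFieldTheory.Balaban1983to89.B8Prop3MultiLevelTorusLap
import Literature.MathematicalPhysics.QuantumFieldTheory.Balaban1983to89.B6Prop26KLevelAssemblyV1
import Literature.MathematicalPhysics.QuantumFieldTheory.Balaban1983to89.B6Cover236QbigOverlapV1
import Literature.MathematicalPhysics.QuantumFieldTheory.Balaban1983to89.B6Prop26KLevelAssemblyV1PerCube
import Literature.MathematicalPhysics.QuantumFieldTheory.Balaban1983to89.B6Prop26KLevelAssemblyPadV1
import Literature.MathematicalPhysics.QuantumFieldTheory.Balaban1983to89.B6Line3CubeV1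
import Literature.MathematicalPhysics.QuantumFieldTheory.Balaban1983to89.B6Prop26GradKLevelV1
import Literature.MathematicalPhysics.QuantumFieldTheory.Balaban1983to89.B8Eq155AbelianMultiLevelTorus

/-!
# `Balaban1983to89.B8Prop3MultiLevelTorusP26` — T. Bałaban, *Spaces of regular gauge field configurations on a lattice and gauge fixing
# conditions*, Commun. Math. Phys. **99** (1985) 75–102 [Balaban1985RegularSpaces], **PROPOSITION 3** p. 87 / **(1.59)** p. 86 AT THE FLAT BACKGROUND
# `U₀ = 1` ON THE `k`-LEVEL V1 TORUS FOR THE GENUINE `G(1) = Δ_a⁻¹`, WITH THE (2.136)₁ MAJORANT OF `G(1)` NO LONGER A HYPOTHESIS: slot 1 of the ROUTE V socket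
# `B8Prop3MultiLevelTorusLap.prop3_multiLevelTorus_V1_pref_vecLap` is FED BY r03's ASSEMBLED `k`-level [B6] Prop. 2.6 (2.136)₁,
# `B6Prop26KLevelAssemblyV1.prop26_2136_kLevel_assembly` — so Proposition 3 at `U₀ = 1` (vector side) now holds MODULO EXACTLY the four displayed
# B6-internal inputs of that assembly ((i) the `□̃`-overlap count, (ii) the output localisation of `M_□h_□`, (iii) the line-1 coefficient sizes and
# supports, (iv) the line-3 majorant — lanes p21 / p38 / p22), the (2.136)₂ majorants of `∇G(1)` (slot 2), and the B8-side hypotheses of the Lap file;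
# v1.1 (§§2–4): inputs (i)–(iii) DISCHARGED by the landed theorems of p21/p38 (via p38's `…AssemblyV1PerCube.prop26_2136_kLevel_assembly_line3` and r03's
# rate-parametrised `…AssemblyV1.prop26_2136_kLevel_final_le`) — ONLY THE LINE-3 MAJORANT (iv) IS LEFT of the per-cube inputs; + the `L = 5` regime with every cube placed;
# v1.2 (§5): EVERY ODD `L ≥ 5`, `k ≥ 1`, `P′ ≥ 5L` WITHOUT the placement hypothesis, the rate a parameter — via p38's level padding `…AssemblyPadV1.prop26_2136_kLevel_final_pad_le_V1`;
# v1.3 (§6): the Lemma-2.1 BUDGET ABSORBED as well (ONE size threshold `M₄ ≤ L·M_h`) — via `…AssemblyPadV1.prop26_2136_kLevel_final_pad_M_V1` (r03's v1.5 `_final_M`, padded):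
# Proposition 3 at `U₀ = 1` (vector side) now modulo LINE 3, SLOT 2 and the B8-side hypotheses ONLY;
# v1.4 (§7): LINE 3 DISCHARGED by r03 g22's `B6Line3CubeV1.line3_cube` (p366020) on the cubes of `padT D` — Proposition 3 at `U₀ = 1` (vector side)
# now modulo SLOT 2 and the B8-side hypotheses ONLY;
# v1.5 (§8): SLOT 2 DISCHARGED as well — p38 g30's `B6Prop26GradKLevelV1.prop26_2136_grad_kLevel_unconditional_pad_V1` ((2.136)₁ ∧ (2.136)₂ for the
# genuine `G`, `∇_ν = DV ν c′`) feeds BOTH slots: Proposition 3 at `U₀ = 1` (vector side) now modulo the B8-side hypotheses ONLY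
# v1.6 (§9): the FIRST B8-SIDE HYPOTHESIS DISCHARGED — (1.55) «|J|₍₋₃₎ ≦ 2α₀ + 36dα₂|∇A|₍₋₂₎ + 50dα₂³ + 10dα₀α₂» DERIVED for the abelian group
# `U(1)` (`U₁ = e^{iηA}`, `A` real) from (1.40) [its (1.9) member, p40's `BondClause19` quantity] and (1.41) by the own `B8Eq155AbelianMultiLevelTorus`:
# Proposition 3 at `U₀ = 1` for `U(1)` fields from (1.40)/(1.41)/(1.42) (Landau + linear average with the (1.56) size line) + smallness + (1.61)
# v1.7 (§10): hypothesis (1.40) VERBATIM — `U₁ = e^{iηA} ∈ 𝔄_k({Ω_j}, α₀)` as membership in p40's typed class `B8Eq17ClassAkV1.ClassAk` ((1.7) ∧ (1.9),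
# `Ω_l` = the sites of level `≥ l` of the torus family, bonds/plaquettes of `Ω_l` by the p. 77 convention) in place of §9's pointwise (1.9) input

statement-level skeleton of published theorems with citation tags; proofs where landed; nothing here is a claim about the Yang–Mills mass gap

PDF held: `paper:balaban1985-cmp99-regular-spaces-gauge-fixing` (journal page = PDF page + 74); p. 86 [PDF 12] (1.58)–(1.59) and Prop. 3 p. 87 [PDF 13] re-read
this generation on the text layer (p0012.txt L22–L31, p0013.txt); [B6] = T. Bałaban, *Propagators and renormalization transformations for lattice gauge
theories. II*, Commun. Math. Phys. **96** (1984) 223–250 [Balaban1984PropagatorsII], Prop. 2.6 (2.136) p. 247 through r03's verbatim quotation in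
`B6Prop26KLevelAssemblyV1` / `B6Prop26KLevelSkeletonV1` (referee-signed files); [4] = T. Bałaban, *Propagators for lattice gauge theories in a background
field*, Commun. Math. Phys. **99** (1985) 389–434 [Balaban1985BackgroundPropagators], Theorem 3.3 p. 399, (3.47) p. 398.

CITATION HEADER (lean-in-tree rule).  Cell `lit-balaban` (HOME `run/shared/lean/pub/lit-balaban/`), unit `lit-balaban-r05` gen 64 (B8 reader/typer and fold owner;
free target under protocol G.5-34(d), TAKING #2 HOME/STATUS.md 2026-08-23T09:33Z, courtesy line to r03 g21 — whose 08:09Z/08:36Z HOME/INBOX lines announce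
`prop26_2136_kLevel_assembly` p358050 ACCEPTED with the words «your deliverables plug into hypotheses (i)–(iv) verbatim»; the successor step (iii-d)
of HOME/lit-balaban-r05/HANDOFF.md §§ gen 61–64; v1.1 = gen 65, the successor step (iii-d) named there, after r03 g21's HOME/INBOX lines 2026-08-23T09:59:28Z /
10:28:18Z naming r05 as the consumer of `…PerCube.prop26_2136_kLevel_assembly_line3` (p38 g29, p360547) and `prop26_2136_kLevel_final_le` (p361529); v1.2 = gen 65 after
p38 g29's `B6Prop26KLevelAssemblyPadV1` p362298 ACCEPTED 570e63547050 (r03's (R6) «general-L top-cube placement» closed by padding); v1.3 = gen 67 after p38 g29's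
`B6Prop26KLevelAssemblyPadV1` v1.1 p364076 ACCEPTED 92bb82197b47 (HOME/STATUS 2026-08-23T12:19:44Z: `prop26_2136_kLevel_final_pad_M(_V1)` = r03 g21's v1.5
`prop26_2136_kLevel_final_M` p362056 — the Lemma-2.1 budget absorbed, one size threshold — at the padded family); v1.4 = gen 69 after r03 g22's
`B6Line3CubeV1` p366020 ACCEPTED 2c68edf3bc53 (HOME/STATUS 2026-08-23T13:38:22Z: `line3_cube` = hypothesis (iv) «line 3 of (2.92) for the genuine cube member»
PROVED, built on p22 g20/21's `B6Line3WindowV1.line3_window`) — the successor step (iii-f) of HOME/lit-balaban-r05/HANDOFF.md §§ gen 65–68).  WHAT IS REPRODUCED = SKELETON rows **B8.Prop3** and **B8.Eq1.59** (cells only; heads unchanged) with a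
courtesy reading of row B6.Prop2.6 (r03; the assembly is r03's file of record), as «kernel-checked proofs of a model instance» on p21's `k`-level nested
torus family `TDomains d ℓ M_h k P′ R` carrying r03's V1 global chart (`B6GlobalChartV1`: `PV`, `blkV1`, `domT`) and p21's Sect.-A calculus
(`B6SectAVectorModelV1`: `G(1) = GE = Δ_a⁻¹`).  Heads do not move (general background = [4] Thm 3.3, r06's block).

WHY, AND WHY NOW.  `B8Prop3MultiLevelTorusLap.prop3_multiLevelTorus_V1_pref_vecLap` (v1.1, this gen) is PROPOSITION 3 at `U₀ = 1` modulo two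
(2.136)-shape majorants as ARGUMENTS — slot 1 `HasMajorant (geomT D) (blkV1 hN D) (onFun G(1)) (C·pref c′ y·e^{−σ′d_T})` and slot 2 (the `∇G(1)`
legs).  r03's `prop26_2136_kLevel_assembly` (ROUTE V (W5)) PROVES slot 1 for the genuine `k`-level `G(1)` with `C := A`, `σ′ := delta3 α (2σ)`, modulo
four displayed B6-internal inputs which the lanes p21/p38/p22 are to deliver «verbatim».  This file composes the two: it kernel-checks that the two
lanes' QUANTIFIER ORDERS (r03: `∃σ ∀α ∀N₀ ∀Nbig ∀s₁ s₂ C_D c_D ∃A M₁ ∀torus…`; B8: `∀σ′ ∃B₀ K_L M₃ N₁ ∀torus… ∀C`), CARRIERS (`PV`/`domT`/`blkV1`/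
`GE … hcf hw`), UNITS (`pref c′`, `GlobalBand b₀ b₁ c′ w`, `η = |c′|⁻¹`) and THRESHOLDS compose — the class of risk behind the gen-62 «units question» —
and it leaves the four B6 inputs as the ONLY open leaves of Proposition 3 at `U₀ = 1` on the vector side besides (2.136)₂.  When (i)–(iv) land, the
hypothesis-free twin is a one-screen re-plumbing (successor item in the seat HANDOFF).

WHAT IS PRINTED (verbatim, p. 86/87; see `B8Prop3MultiLevelTorusLap` for the full quotations).  p. 86: *"Theorem 3.3 of [4] implies the bounds: |A|₍₋₁₎,
|∇^η_{U₀}A|₍₋₂₎, |D^{η*}_{U₀}D^η_{U₀}A|₍₋₃₎, |Δ^η_{U₀}A|₍₋₃₎ ≦ B₀(|J|₍₋₃₎ + |B₁|) (1.59)"*; Prop. 3 p. 87: *"then U₁ satisfies (1.36)–(1.39) with B₁ = 5dLB₀,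
B₂(β₀) = 5dLB₀(β₀), where B₀, B₀(β₀) are the corresponding norms of the operators G(U₀), H(U₀), and depend on d and L only"*.  [B6] Prop. 2.6 p. 247
(2.136): *"|(GJ)(x)|, |(∇GJ)(x)|, |(G∇*J)(x)|, |(ΔGJ)(x)| ≦ O(1)[(Lʲη)², Lʲη, Lʲη, 1]e^{−δ₃d(y,y′)}‖J‖ for x ∈ Δ(y), supp J ⊂ Δ(y′)"* (through r03's quotation).

WHAT THIS FILE PROVES (ELEVEN theorems — two of v1.0, three of v1.1, one each of v1.2, v1.3, v1.4, v1.5, v1.6, v1.7; 0 `def`, 0 `def … : Prop`, 0 sorry; imports `B8Prop3MultiLevelTorusLap` (own, v1.1) +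
`B6Prop26KLevelAssemblyV1` (r03, v1.4) + `B6Cover236QbigOverlapV1` (p21/r03) + `B6Prop26KLevelAssemblyV1PerCube` (p38 g29, v1.1 of this file) +
`B6Prop26KLevelAssemblyPadV1` (p38 g29; its v1.0 for v1.2 of this file, its v1.1 for v1.3) + `B6Line3CubeV1` (r03 g22; v1.4) + `B6Prop26GradKLevelV1` (p38 g30; v1.5) +
`B8Eq155AbelianMultiLevelTorus` (own, r05 gen 70; v1.6)).  **`prop3_multiLevelTorus_V1_P26`** — for the weight band `0 < b₀ ≤ b₁` there is `σ > 0` (r03's) such that for every budget `α ∈ [0, 1)` there are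
`B₀ ≥ 1`, `K_L ≥ 1`, `M₃ > 0`, `N₁` (functions of `d, ℓ` and `σ′ = delta3 α (2σ) = (1 − α)σ`) such that for all `N₀ ≥ 1`, `Nbig`, `s₁, s₂, C_D ≥ 0`, `c_D > 0`
there are `A ≥ 0`, `M₁ > 0` (r03's) such that ON EVERY ADMISSIBLE `k`-LEVEL V1 TORUS (r03's thresholds `k ≥ 2`, `M_h = Lᵃ ≥ 8`, `R ≥ 2L²`, `P′ ≥ 5`, `L ≥ 5`,
cubes `Placed`, `M₁ ≤ L·M_h`, `N₀ + 1 ≤ R·L·M_h`, `e^{−ασ}L^{2(d+1)/N₀} < 1`; plus this lineage's `M₃ ≤ L·M_h`, `N₁ + 1 ≤ R·L·M_h`), for `c′ ≠ 0`, weights `w > 0`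
in `GlobalBand b₀ b₁ c′ w`, GIVEN r03's four displayed inputs (i)–(iv) VERBATIM and the slot-2 majorants of `Dop ν ∘ onFun G(1)` with constant `A` and rate
`σ′`: every `A`-field with (1.55) `∂*∂A = J`, (1.42) `R∂*A = 0`, (1.56) `QA = B` and the size lines (as in the Lap file, `C` replaced by r03's `A`) satisfies
THE SEVEN CONCLUSIONS of `prop3_multiLevelTorus_V1_pref_vecLap` — the four `msup (ℓ+1) k η ·` members (1.59)/(1.62) incl. print's componentwise
`|Δ^η_{U₀}A|₍₋₃₎` at `U₀ = 1` and the three pointwise «on Ω_j» forms — with `B₀′ = K_L(B₀A + 1)(1 + 2b₁)`.  Proof = plumbing: r03's `σ`; `σ′ > 0` by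
`B6RandomWalk.delta3_pos`; this lineage's constants at `σ′`; r03's `A, M₁`; r03's conclusion IS slot 1 with `C := A` (syntactically); r03's thresholds imply
this lineage's weaker ones (`8 ≤ M_h ⇒ 1 ≤ M_h`, `2L² ≤ R ⇒ 2L ≤ R`, `5 ≤ P′ ⇒ 4 ≤ P′`).  **`prop3_multiLevelTorus_V1_P26_nbig`** — the same with
r03's input (i) DISCHARGED (the `□̃` overlap count holds with `Nbig = 3·9^{d+1}` on every admissible torus: p21/r03's
`B6Cover236QbigOverlapV1.card_filter_mem_QbigT_le`, p359412; r03's own B6-side twin is `prop26_2136_kLevel_assembly_nbig`), i.e. PROPOSITION 3 at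
`U₀ = 1` modulo the THREE per-cube inputs (ii)–(iv), slot 2 and the B8-side hypotheses.

v1.1 (§§2–4, THREE theorems, pure plumbing).  **`prop3_multiLevelTorus_V1_P26_line3`** — inputs (i)–(iii) DISCHARGED: slot 1 fed by p38 g29's
`B6Prop26KLevelAssemblyV1PerCube.prop26_2136_kLevel_assembly_line3` (r03's assembly with (i) `Nbig = 3·9^{d+1}`, (ii) `B6CubeMoutV1.outLoc_Ml_hB'`, (iii)
`B6CubeCoeffSizesV1.abs_cfC_le`/`cfC_supp`/`abs_c0C_le`/`c0C_supp` inside), so PROPOSITION 3 AT `U₀ = 1` ON THE `k`-LEVEL V1 TORUS NOW HOLDS MODULO: the line-3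
majorant (iv) of `ζ_□(∂(1−R)∂* − P_□)h_□` (ONE displayed analytic per-cube input; lanes p38/p22), the Lemma-2.1 budget `(α, N₀)`, the slot-2 majorants of `∇G(1)`
((2.136)₂, no `k`-level producer) and the B8-side hypotheses; quantifiers `∃σ ∀α ∃B₀ K_L M₃ N₁ ∀N₀ ∀C_D c_D ∃A M₁ ∀torus…`.  **`prop3_multiLevelTorus_V1_P26_line3_le`**
— the same with THE RATE A PARAMETER (`∃ σ₀ > 0, ∀ σ ∈ (0, σ₀]`), slot 1 fed by r03's `B6Prop26KLevelAssemblyV1.prop26_2136_kLevel_final_le` (v1.4): a line-3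
theorem proved at its own rate `ρ₃` is consumed at `σ := min σ₀ (ρ₃/2)` without re-opening any file.  **`prop3_multiLevelTorus_V1_P26_L5_line3`** — the `L = 5`
(`ℓ = 4`), `P′ ≥ 12` regime where r03's canonical chart places every cube (`B6CubeWindowV1.placed_all_cubes`): no geometric per-cube hypothesis left.

v1.2 (§5, ONE theorem, pure plumbing).  **`prop3_multiLevelTorus_V1_P26_pad_line3_le`** — slot 1 fed by p38 g29's
`B6Prop26KLevelAssemblyPadV1.prop26_2136_kLevel_final_pad_le_V1` (p362298): PROPOSITION 3 AT `U₀ = 1` ON THE `k`-LEVEL V1 TORUS FOR EVERY ODD `L ≥ 5`, `k ≥ 1`,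
`P′ ≥ 5L`, WITHOUT the placement hypothesis (discharged by p38's level padding `B6PadLevelV1.padT`), the rate a parameter (`σ ∈ (0, σ₀]`), modulo: the line-3
majorant (iv) for the members of the cubes of the padded family `padT D`, the Lemma-2.1 budget, slot 2 and the B8-side hypotheses.  This supersedes §4 in
generality (every odd `L ≥ 5` instead of `L = 5`) at the price of stating (iv) on `padT D`.

v1.3 (§6, ONE theorem, pure plumbing).  **`prop3_multiLevelTorus_V1_P26_pad_M`** — slot 1 fed by p38 g29's
`B6Prop26KLevelAssemblyPadV1.prop26_2136_kLevel_final_pad_M_V1` (v1.1, p364076; inside: r03 g21's v1.5 `B6Prop26KLevelAssemblyV1.prop26_2136_kLevel_final_M`,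
which for `α > 0` chooses the Lemma-2.1 exponent `N₀` itself and keeps ONE size threshold): PROPOSITION 3 AT `U₀ = 1` ON THE `k`-LEVEL V1 TORUS FOR EVERY
ODD `L ≥ 5`, `k ≥ 1`, `P′ ≥ 5L`, no placement hypothesis, NO LEMMA-2.1 BUDGET (`α ∈ (0, 1)` only), the rate a parameter (`σ ∈ (0, σ₀]`), ONE size threshold
`M₄ ≤ L·M_h` (the assembly's `M₂` and this lineage's `M₃`, `N₁ + 1` folded into `M₄ := max M₂ (max M₃ (N₁ + 1))`), modulo: the line-3 majorant (iv) for the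
members of the cubes of `padT D`, slot 2 and the B8-side hypotheses — NOTHING ELSE.  Quantifiers `∃σ₀ ∀σ ∀α ∃B₀ K_L ∀C_D c_D ∃A M₄ ∀torus…`.

v1.4 (§7, ONE theorem, pure plumbing).  **`prop3_multiLevelTorus_V1_P26_free`** — §6 with its LAST per-cube analytic input, the line-3 majorant (iv)
for the members of the cubes of `padT D`, DISCHARGED by r03 g22's `B6Line3CubeV1.line3_cube` (p366020 ✓ 2c68edf3bc53) applied to the `(k+1)`-level
family `padT D` (every cube placed, p38's `placed_pad`; `k + 1 ≥ 2`), its rate `ρ₃` weakened to `2σ` for `σ ≤ min σ₀ (ρ₃/2)` (`hasMajorant_mono`,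
`dist_nonneg_TB`), its constants `C_D, c_D` fed to §6 and its threshold `M₃` folded into the ONE threshold `max M₄ M₃ ≤ L·M_h`: PROPOSITION 3 AT
`U₀ = 1` ON THE `k`-LEVEL V1 TORUS FOR EVERY ODD `L ≥ 5`, `k ≥ 1`, `P′ ≥ 5L` — NO per-cube hypothesis, NO placement, NO budget — modulo the slot-2
majorants of `∇G(1)` and the B8-side hypotheses ONLY.  Quantifiers `∃σ₀ ∀σ ∀α ∃B₀ K_L A M₄ ∀torus…`.

v1.5 (§8, ONE theorem, pure plumbing).  **`prop3_multiLevelTorus_V1_P26_vector`** — §7 with its slot-2 hypothesis (the (2.136)₂-shape majorants of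
`Dop ν ∘ onFun G(1)` for an abstract first-order `Dop`) DISCHARGED TOO: BOTH slots of `B8Prop3MultiLevelTorusLap.prop3_multiLevelTorus_V1_pref_vecLap` are fed,
with ONE constant `A` and the rate `delta3 α (2σ)`, by p38 g30's `B6Prop26GradKLevelV1.prop26_2136_grad_kLevel_unconditional_pad_V1` ((F4): r03's two-family
gluing + p38's pair assembly (2.136)₁, the `∇`-legs `B6GradLegKLevelV1` with `∇_ν := DV ν c′ = c′·(S_ν − 1)` ([B5] (1.4) p. 18 at `U₀ = 1`), line 3 by r03 g22's
`B6Line3CubeV1.line3_cube` on `padT D`, the Lemma-2.1 budget chosen inside), so `Dop ν` IS NOW THE CONCRETE `DV ν c′`: PROPOSITION 3 AT `U₀ = 1` ON THE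
`k`-LEVEL V1 TORUS FOR EVERY ODD `L ≥ 5`, `k ≥ 1`, `P′ ≥ 5L` — no per-cube hypothesis, no placement, no budget, NO [B6]-SIDE HYPOTHESIS AT ALL — modulo the
B8-side hypotheses ((1.55)/(1.42)/(1.56) + the size lines) ONLY; ONE size threshold `M₄ ≤ L·M_h` (p38's `M₂`, this lineage's `M₃`, `N₁ + 1`).
Quantifiers `∃σ₀ ∀σ ∀α ∃B₀ K_L A M₄ ∀torus ∀A J B …`.

v1.6 (§9, ONE theorem, pure plumbing; r05 gen 70, 2026-08-23).  **`prop3_multiLevelTorus_V1_P26_U1`** — §8 with THE FIRST OF ITS B8-SIDE HYPOTHESES, the (1.55) size line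
«D^{η*}_{U₀}D^η_{U₀}A = J, |J|₍₋₃₎ ≦ 2α₀ + 36dα₂|∇^η_{U₀}A|₍₋₂₎ + 50dα₂³ + 10dα₀α₂» (p. 86), NO LONGER ASSUMED BUT DERIVED — for the abelian gauge group `U(1)`
(`U₁(b) = e^{iηA(b)}` for the REAL bond function `A`, `η = |c′|⁻¹`; the cell's `U(1)` = `T4CubeChartCircle.U1`) from the printed hypotheses (1.40) (its (1.9)
member for `U₁`, *"|(D^{η*}_U ∂U)(b)| < α₀L^{−2j}(Lʲη)⁻¹ for b ∈ Ω_j"*, the quantity of p40's typed `B8Eq17ClassAkV1.BondClause19` with `R = Ad ≡ id`, `ι : U(1) ⊂ ℂ`;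
the `U₀ = 1` half holds with `0`) and (1.41) *"|A| < α₂(Lʲη)⁻¹ on Ω_j"*, by the own `B8Eq155AbelianMultiLevelTorus.ineq155_abelian_kLevel` (pp. 84–86 (1.47)–(1.55)
for `U(1)`: `U₁(∂p) = e^{iη²(D^ηA)(p)}`, the commutator brace of (1.50) ≡ 0 so `V₂` is real and the (1.51)–(1.53) term does not enter the anti-Hermitian part
`iη²J`; sharper abelian constant `n_J = α₀ + (128/5)dL³α₂³`, the `L³` being the located one-layer-wider reading of «on Ω_j» (GAPS G-B8-16) in the `blkV1`
encoding — whence print's `d` is read as any real `d_P ≥ d·L³`).  PROPOSITION 3 AT `U₀ = 1` ON THE `k`-LEVEL V1 TORUS FOR `U(1)` FIELDS — every odd `L ≥ 5`,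
`k ≥ 1`, `P′ ≥ 5L`, no [B6]-side hypothesis — FROM (1.40), (1.41), (1.42) (Landau `R∂*A = 0`; LINEAR average `QA = B` with the (1.56) size line
«|B₁| < 2dLα₁ + C₂α₂²» still a hypothesis: print's non-linear average `Q_j(U₀, ηA)` of [3] is not modelled on the torus), the smallness lines and (1.61).
Quantifiers `∃σ₀ ∀σ ∀α ∃B₀ K_L A M₄ ∀torus ∀A B ∀α₀ α₂ …`.
v1.7 (§10, ONE theorem, pure plumbing; r05 gen 70, 2026-08-23).  **`prop3_multiLevelTorus_V1_P26_U1_classAk`** — §9 with hypothesis (1.40) IN ITS PRINTED FORM: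
*"U₀, U₁U₀ ∈ 𝔄_k({Ω_j}, α₀)"* (p. 83) at `U₀ = 1`, i.e. the class membership `U₁ = e^{iηA} ∈ 𝔄_k({Ω_j}, α₀)` typed by p40 as
`B8Eq17ClassAkV1.ClassAk adU1 entryU1 Ω k η L α₀ U₁` = (1.7) ∧ (1.9) of p. 77 for the site domains `Ω_l := {x : l ≤ j(x)}` of the torus family (`j(x) = D.lev (toBox x)`),
their bonds and plaquettes by the p. 77 convention (`B15DeterminingSets.bondsOf`: a bond belongs to `Ω_l` as soon as one endpoint does; `plaqsOf`), `η = |c′|⁻¹`,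
`L = ℓ + 1` — replacing §9's pointwise (1.9) input, which is the bond clause restricted to initial points (`bondClause19_anti_set`, own `h40_of_bondClause19`); the
plaquette clause (1.7) is carried and not used by the proof (a genuine assumption, as in print; (1.41) alone gives only print՚s p. 84 size `|U₁(∂p) − 1| = O(α₂(Lʲη)⁻¹η)`); the
`U₀`-half of (1.40) holds at `U₀ = 1` (`classAk_one`) and «(3.35) of [4]»
is void for the flat background.  Everything else as in §9.

HONEST SCOPE / NOT CLAIMED.  (i) CONDITIONAL on r03's displayed inputs (i)–(iv), passed through VERBATIM (binders copied from `prop26_2136_kLevel_assembly`;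
their producers: p21 (`QbigT` count), p38 (`OutLoc`, `cfC`/`c0C` sizes and supports), p38/p22 (line 3) — in progress 2026-08-23; v1.1: (i)–(iii) DISCHARGED by
the landed producers, (iv) line 3 REMAINS a displayed hypothesis — p38 `line3P_hasMajorant_gk_zone_cut` + p22 `B6Line3WindowV1` in progress; v1.3: the Lemma-2.1 budget `(α, N₀)`
is no longer displayed (absorbed on the B6 side for `α > 0`), line 3 STILL IS — r03 g22's `hD3_cube` ⇒ `prop26_2136_kLevel_unconditional` in progress
2026-08-23T12:30Z, inputs `B6Line3ChiCutoffV1`/`CutoffV1`/`GapV1`/`ProfileV1` landed; v1.4: line 3 LANDED (`B6Line3CubeV1.line3_cube`, p366020 ✓) and is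
DISCHARGED in §7 — of r03's four per-cube inputs NONE is displayed any more; what remains displayed is slot 2 (p38 g30's (F1)–(F4)
`B6Prop26GradKLevelV1.prop26_2136_grad_kLevel_line3`, in flight 2026-08-23T13:5xZ) and the B8-side hypotheses; v1.5: slot 2 LANDED too (p38 g30's
`B6Prop26GradKLevelV1.prop26_2136_grad_kLevel_unconditional_pad_V1`) and §8 feeds both slots — NO [B6]-side hypothesis is displayed any more), on the slot-2 majorants
(§§1–7: no `k`-level producer of (2.136)₂ consumed; §8: produced), and on (1.55)/(1.42)/(1.56) + the size lines (1.55)/(1.56)/(1.61)/«B₀′36dα₂ ≦ ½»/«50dα₂ ≦ 1» as hypotheses, exactly as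
in `B8Prop3MultiLevelTorusLap` — v1.6 (§9): the (1.55) size line is DERIVED for `U(1)` fields `U₁ = e^{iηA}` from (1.40) [(1.9) for `U₁`] and (1.41); STILL
HYPOTHESES in §9 (and in §10, v1.7, where (1.40) enters verbatim as p40's `ClassAk` membership): the Landau clause of (1.42), the linear-average clause with its (1.56) size line, the smallness lines, (1.61); the abelian group only (the
non-abelian (1.43)–(1.55) are PROVED on the ℤᵈ carriers — `B8Eq143PlaqExpansion`/`B8Eq146AExpansion`/`B8Eq151V2Divergence`/`B8Eq155JBound`, LOCAL forms
`B8Eq148Local`/`B8Eq154Local` — with `𝔤`-valued fields this scalar lane does not carry).  (ii) The abstract first-order `Dop ν` stands for `∇^η_{U₀}|_{U₀=1}` componentwise (consumer's choice; e.g. p22's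
`c • (onE (funLeft (shift ν)) − id)`); in §8 it IS p38's `B6GradLegKLevelV1.DV ν c′ = c′ • (shB ν − 1)`, the forward difference of fine bond functions in the direction `ν`
— print's `∇^η_{U₀}A` at `U₀ = 1` componentwise, NOT the covariant derivative at a general `U₀`).  (iii) Real scalar fibre; lattice units with `η = |c′|⁻¹`; levels `1 … k`, `Ω₁ = T_η`; constants existential, thresholds
explicit; r03's `A, M₁` depend on `d, L, b₀, b₁, α, N₀, Nbig, s₁, s₂, C_D, c_D` (his docstring), this lineage's `B₀, K_L, M₃, N₁` on `d, L, σ′`.  (iv) Rows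
B8.Prop3 / B8.Eq1.59 heads do NOT move.  NOT summit progress, NOT continuum, NOT Clay.

RELATED IN THE TREE, NOT DUPLICATED (stem check 2026-08-23T09:35Z: `ls Balaban1983to89 | grep -i 'P26\|Prop3.*Torus'` — no `…P26` file; r03's assembly has
no B8 consumer yet): `B8Prop3MultiLevelTorusLap.prop3_multiLevelTorus_V1_pref_vecLap` (own), `B6Prop26KLevelAssemblyV1.prop26_2136_kLevel_assembly` (r03),
`B6Cover236QbigOverlapV1.card_filter_mem_QbigT_le` (p21/r03), `B6RandomWalk.delta3/delta3_pos` (USED BY NAME; nothing re-declared); v1.1 (stem check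
2026-08-23T10:50Z: no other B8 consumer of the two names): `B6Prop26KLevelAssemblyV1PerCube.prop26_2136_kLevel_assembly_line3`/`_L5_line3` (p38 g29),
`B6Prop26KLevelAssemblyV1.prop26_2136_kLevel_final_le` (r03 g21 v1.4), `B6CubeWindowV1.placed_all_cubes` (r03) — USED BY NAME; v1.2:
`B6Prop26KLevelAssemblyPadV1.prop26_2136_kLevel_final_pad_le_V1`/`hLP_of_V1`/`hP5_of_V1`/`hk'_of_V1` (p38 g29), `B6PadLevelV1.padT`/`hN_pad`/`placed_pad`/
`sameOm_domT_pad` (p38 g29) — USED BY NAME (stem check 2026-08-23T11:25Z: no other consumer of `B6Prop26KLevelAssemblyPadV1`); v1.3: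
`B6Prop26KLevelAssemblyPadV1.prop26_2136_kLevel_final_pad_M_V1` (p38 g29 v1.1; r03 g21's `B6Prop26KLevelAssemblyV1.prop26_2136_kLevel_final_M` v1.5 inside) —
USED BY NAME (stem check 2026-08-23T12:32Z: `grep -l 'prop26_2136_kLevel_final_pad_M\|prop26_2136_kLevel_final_M' Balaban1983to89/*.lean` = the two producer
files only; no consumer in any block); v1.4: `B6Line3CubeV1.line3_cube` (r03 g22, p366020), `B6Ineq2134KLevelTorus.dist_nonneg_TB` — USED BY NAME (stem check
2026-08-23T13:57Z: `grep -l 'line3_cube' Balaban1983to89/*.lean` = `B6Line3CubeV1.lean` only; this file is its first consumer); v1.5: `B6Prop26GradKLevelV1.prop26_2136_grad_kLevel_unconditional_pad_V1` (p38 g30 (F4),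
p367862 ✓), `B6GradLegKLevelV1.DV` (p38 g30 (F3), p366336 ✓ 80541ae8e1ad) — USED BY NAME (stem check 2026-08-23T16:2xZ: `grep -l 'prop26_2136_grad_kLevel' Balaban1983to89/*.lean`
= the producer, p22 g22's `B6Line3CubePadV1` (a docstring mention) and this file (v1.4 docstring) only; this file is its first consumer); v1.6:
`B8Eq155AbelianMultiLevelTorus.ineq155_abelian_kLevel`/`adU1`/`entryU1`/`expCfg` (own, r05 gen 70, filed with this version), `B8Eq17ClassAkV1.BondClause19` (p40; the
(1.9) shape), `T4CubeChartCircle.U1`/`expU` (the cell's `U(1)`), `LatticeFieldCalculus.covDivPlaq`, `Setup.GaugeField.plaqHol` — USED BY NAME (stem check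
2026-08-23T20:20Z: `ls Balaban1983to89 | grep -i 'Eq155\|Abelian'` = `B8Eq155JBound` (ℤᵈ), `B8Lemma1Abelian`, `B8Thm8FlatAbelianFamily`; no (1.55) on the V1 torus); v1.7: p40's
full class `B8Eq17ClassAkV1.ClassAk` + `bondClause19_anti_set`, `B15DeterminingSets.bondsOf` — USED BY NAME (stem check 2026-08-23T23:1xZ:
`grep -l 'ClassAk ' Balaban1983to89/*.lean` = p40's `B8Eq17ClassAkV1`/`B8Prop7ClassAkLocal`/`B8Prop7AdmittedFamily`/`B8Ineq1144TwistedAxial`, `B15Chi124DetSets`, own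
`B8Eq155AbelianMultiLevelTorus`; this file is the first to consume the class inside a Proposition-3 statement).
-/

open scoped BigOperators
open Finset

namespace Literature.MathematicalPhysics.QuantumFieldTheory.Balaban1983to89.B8Prop3MultiLevelTorusP26

open B4Reflection242 (boxDom)
open B6MultiLevelBoxOperator (N0)
open B6MultiLevelTorusOperator (TDomains)
open B6Cover236MultiLevelBlocks (cubes)
open B6Geom246MultiLevelBox (bset blkOf)
open B6Geom246MultiLevelTorus (geomT bondT)
open B8Ineq192MultiLevelTorus (geomTB geomTB_len geomTB_M geomTB_dist)
open B6RandomWalk (HasMajorant hasMajorant_mono delta3 delta3_pos BlockSupp)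
open B6Prop26Gluing (mulOp mulOp_apply LocalMajorant OutLoc)
open B6Ineq2133TwoScaleV1 (onFun)
open B6GlobalChartV1 (PV toBox domT blkV1)
open B6SectAOperatorsV1 (dE dsE dcE dcsE QE aE QsE RE BondIdx BondIdxSpace)
open B6SectAVectorModelV1 (GE)
open B6Partition118KLevelTorusCentral (QT QbigT)
open B6Prop26KLevelSkeletonV1 (hB zB ST pref)
open B6Prop26KLevelSkeletonV2 (SbigT)
open B6CubeWindowV1 (Placed Gl Ml Pl GlobalBand band_le one_le_of_eight_le four_le_of_five_le placed_all_cubes)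
open B6Eq292MemberTorusV1 (EC cfC c0C NC zC)
open B6Prop26KLevelAssemblyV1 (prop26_2136_kLevel_assembly prop26_2136_kLevel_final_le)
open B6Prop26KLevelAssemblyV1PerCube (prop26_2136_kLevel_assembly_line3)
open B6Prop26KLevelAssemblyPadV1 (prop26_2136_kLevel_final_pad_le_V1 prop26_2136_kLevel_final_pad_M_V1 hLP_of_V1 hP5_of_V1 hk'_of_V1)
open B6PadLevelV1 (padT hN_pad placed_pad sameOm_domT_pad)
open B6Line3CubeV1 (line3_cube)
open B6Prop26GradKLevelV1 (prop26_2136_grad_kLevel_unconditional_pad_V1)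
open B6GradLegKLevelV1 (DV)
open B6Ineq2134KLevelTorus (dist_nonneg_TB)
open B6Cover236QbigOverlapV1 (card_filter_mem_QbigT_le)
open BalabanImbrieJaffe1984to88.BIJ85AxialPropagator411 (BondSpace)
open B8ScaledSupNorm (msup)
open LatticeFieldCalculus (laplace)
open B8Prop3MultiLevelTorusLap (prop3_multiLevelTorus_V1_pref_vecLap)

noncomputable section

open Classical in
/-- **[B8] PROPOSITION 3 AT `U₀ = 1` ON THE `k`-LEVEL V1 TORUS, SLOT 1 FED BY r03's ASSEMBLED (2.136)₁** (p. 87, verbatim: *"then U₁ satisfies (1.36)–(1.39)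
with B₁ = 5dLB₀, B₂(β₀) = 5dLB₀(β₀), where B₀, B₀(β₀) are the corresponding norms of the operators G(U₀), H(U₀), and depend on d and L only"*; (1.59) p. 86
*"|A|₍₋₁₎, |∇^η_{U₀}A|₍₋₂₎, |D^{η*}_{U₀}D^η_{U₀}A|₍₋₃₎, |Δ^η_{U₀}A|₍₋₃₎ ≦ B₀(|J|₍₋₃₎ + |B₁|)"*) — typed reading: `B8Prop3MultiLevelTorusLap.prop3_multiLevelTorus_V1_pref_vecLap`
with its slot-1 hypothesis (the [B6] (2.136)₁-shape majorant of `onFun G(1)`) DISCHARGED by `B6Prop26KLevelAssemblyV1.prop26_2136_kLevel_assembly` (constant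
`A`, rate `delta3 α (2σ)`), hence conditional on exactly that theorem's displayed inputs (i)–(iv) (binders VERBATIM), the slot-2 majorants of
`Dop ν ∘ onFun G(1)`, and the B8-side hypotheses (1.55)/(1.42)/(1.56) + size lines; conclusions = the seven of the Lap file (four `msup (ℓ+1) k η ·` members,
the fourth for print's componentwise `Δ^η_{U₀}|_{U₀=1}`, + three pointwise «on Ω_j» forms) with `B₀′ = K_L(B₀A + 1)(1 + 2b₁)`; thresholds = r03's ∪ {`M₃ ≤ L·M_h`,
`N₁ + 1 ≤ R·L·M_h`}. [cite: Balaban1985RegularSpaces, Prop. 3 p.87, (1.59)–(1.62) pp.86–87, (1.55)–(1.58) p.86, (1.42) p.84; Balaban1984PropagatorsII, Prop. 2.6 (2.136) p.247, (2.133)–(2.135) p.247, (2.16) p.225, (2.19) p.226; Balaban1985BackgroundPropagators, Theorem 3.3 p.399, (3.47) p.398] -/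
theorem prop3_multiLevelTorus_V1_P26 (d ℓ : ℕ) (hd : 1 ≤ d + 1) (hL : Odd (ℓ + 1) ∧ 1 < ℓ + 1) {b₀ b₁ : ℝ} (hb₀ : 0 < b₀) (hb₁ : b₀ ≤ b₁) :
    ∃ σ : ℝ, 0 < σ ∧ ∀ (α : ℝ), 0 ≤ α → α < 1 →
    ∃ B₀ KL M₃ : ℝ, ∃ N₁ : ℕ, 1 ≤ B₀ ∧ 1 ≤ KL ∧ 0 < M₃ ∧ 0 < N₁ ∧
    ∀ (N₀ : ℕ), 0 < N₀ → ∀ (Nbig : ℕ) {s₁ s₂ CD cD : ℝ}, 0 ≤ s₁ → 0 ≤ s₂ → 0 ≤ CD → 0 < cD →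
    ∃ Amaj M₁ : ℝ, 0 ≤ Amaj ∧ 0 < M₁ ∧
    ∀ (m K : ℕ) {Mh k R : ℕ} {P' : Fin (d + 1) → ℕ}
      (hN : ∀ μ, N0 ℓ Mh k P' μ = (PV d ℓ m K hd hL).sitesPerDir 0) (D : TDomains d ℓ Mh k P' R) (hk : k ≤ m + K) (_ : 2 ≤ k)
      {a : ℕ} (hMha : Mh = (ℓ + 1) ^ a) (hM8 : 8 ≤ Mh) (_ : 2 * (ℓ + 1) ^ 2 ≤ R) (hP5 : ∀ μ, 5 ≤ P' μ) (_ : 4 ≤ ℓ)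
      (hpl : ∀ c : ↥(cubes D.toDomains), Placed ℓ k P' c.1)
      (_ : M₁ ≤ ((ℓ : ℝ) + 1) * Mh) (_ : M₃ ≤ ((ℓ : ℝ) + 1) * Mh) (_ : N₀ + 1 ≤ R * ((ℓ + 1) * Mh)) (_ : N₁ + 1 ≤ R * ((ℓ + 1) * Mh))
      (_ : Real.exp (-(α * σ)) * ((ℓ : ℝ) + 1) ^ ((2 * (d + 1 : ℕ) : ℝ) / N₀) < 1)
      {cf : ℝ} (hcf : cf ≠ 0) {w : BondIdx (domT hN D hk) → ℝ} (hw : ∀ i, 0 < w i) (_ : GlobalBand b₀ b₁ cf w)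
      -- r03's displayed input (i): the overlap count of the `□̃` (p21)
      (_ : ∀ y : (geomT D).Site, (Finset.univ.filter fun c : ↥(cubes D.toDomains) =>
        y ∈ QbigT D (one_le_of_eight_le hM8) (four_le_of_five_le hP5) c).card ≤ Nbig)
      -- (ii): the output localisation of `M_□h_□` (p38)
      (_ : ∀ c : ↥(cubes D.toDomains), OutLoc (g := geomT D) (blkV1 hN D)
        (Ml hN hk (one_le_of_eight_le hM8) (four_le_of_five_le hP5) hMha c (band_le (d := d) (ℓ := ℓ) hb₀ hb₁) (hpl c) w cf * mulOp (hB hN D c))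
        (SbigT D (one_le_of_eight_le hM8) (four_le_of_five_le hP5) c))
      -- (iii): the line-1 coefficients, sizes and supports (p38)
      (_ : ∀ (c : ↥(cubes D.toDomains)) (e : Fin (d + 1) × Bool) (x : PBond (PV d ℓ m K hd hL) 0),
        |cfC hN hk (one_le_of_eight_le hM8) (four_le_of_five_le hP5) hMha c (band_le (d := d) (ℓ := ℓ) hb₀ hb₁) (hpl c) w cf e x| ≤
          s₁ * cf ^ 2 / ((geomTB D).M * (geomTB D).len (blkV1 hN D x) ^ 2))
      (_ : ∀ (c : ↥(cubes D.toDomains)) (e : Fin (d + 1) × Bool) (x : PBond (PV d ℓ m K hd hL) 0),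
        cfC hN hk (one_le_of_eight_le hM8) (four_le_of_five_le hP5) hMha c (band_le (d := d) (ℓ := ℓ) hb₀ hb₁) (hpl c) w cf e x ≠ 0 →
          blkV1 hN D x ∈ ST D (one_le_of_eight_le hM8) (four_le_of_five_le hP5) c)
      (_ : ∀ (c : ↥(cubes D.toDomains)) (x : PBond (PV d ℓ m K hd hL) 0),
        |c0C hN hk (one_le_of_eight_le hM8) (four_le_of_five_le hP5) hMha c (band_le (d := d) (ℓ := ℓ) hb₀ hb₁) (hpl c) w cf x| ≤
          s₂ * cf ^ 2 / ((geomTB D).M * (geomTB D).len (blkV1 hN D x) ^ 2))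
      (_ : ∀ (c : ↥(cubes D.toDomains)) (x : PBond (PV d ℓ m K hd hL) 0),
        c0C hN hk (one_le_of_eight_le hM8) (four_le_of_five_le hP5) hMha c (band_le (d := d) (ℓ := ℓ) hb₀ hb₁) (hpl c) w cf x ≠ 0 →
          blkV1 hN D x ∈ ST D (one_le_of_eight_le hM8) (four_le_of_five_le hP5) c)
      -- (iv): line 3 (p38/p22)
      (_ : ∀ c : ↥(cubes D.toDomains), HasMajorant (g := geomTB D) (blkV1 hN D)
        (mulOp (zB hN D (one_le_of_eight_le hM8) (four_le_of_five_le hP5) c) *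
          (onFun (dE (P := PV d ℓ m K hd hL) cf ∘ₗ (LinearMap.id - RE (domT hN D hk) cf) ∘ₗ dsE cf) -
            Pl hN hk (one_le_of_eight_le hM8) (four_le_of_five_le hP5) hMha c (band_le (d := d) (ℓ := ℓ) hb₀ hb₁) (hpl c) w cf) *
          mulOp (hB hN D c))
        (fun y y'' => CD * cf ^ 2 * Real.exp (-(cD * (geomTB D).M)) / (geomTB D).len y ^ 2 * Real.exp (-((2 * σ) * (geomTB D).dist y y''))))
      -- slot 2: the (2.136)₂-shape majorants of `∇G(1)` for the abstract first-order `Dop ν` (no k-level producer yet)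
      (Dop : Fin (d + 1) → Module.End ℝ (PBond (PV d ℓ m K hd hL) 0 → ℝ)),
      (∀ ν, HasMajorant (g := geomT D) (blkV1 hN D) (Dop ν ∘ₗ onFun (GE (domT hN D hk) hcf hw))
        (fun y y' => Amaj * ((geomT D).len y * |cf|⁻¹) * Real.exp (-(delta3 α (2 * σ) * (geomT D).dist y y')))) →
      ∀ (A J : BondSpace (PV d ℓ m K hd hL)) (B : BondIdxSpace (domT hN D hk)),
        dcsE cf (dcE cf A) = J → RE (domT hN D hk) cf (dsE cf A) = 0 → QE (domT hN D hk) A = B →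
        ∀ (nJ nB : ℝ), 0 ≤ nJ → 0 ≤ nB →
          (∀ b, |J b| ≤ nJ * (((geomT D).len (blkV1 hN D b) * |cf|⁻¹) ^ 3)⁻¹) →
          (∀ i, |B i| ≤ nB * (((ℓ : ℝ) + 1) ^ (i.1.1 : ℕ) * |cf|⁻¹)⁻¹) →
        ∀ (dP LP C₂ α₀ α₁ α₂ : ℝ), 0 ≤ dP → 1 ≤ dP * LP → 0 ≤ α₀ → 0 ≤ α₁ → 0 ≤ α₂ →
          nJ ≤ 2 * α₀ + 36 * dP * α₂ *
              msup (ℓ + 1) k |cf|⁻¹ (-2) (fun j (p : Fin (d + 1) × PBond (PV d ℓ m K hd hL) 0) => j ≤ (blkV1 hN D p.2).1.1)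
                (fun p : Fin (d + 1) × PBond (PV d ℓ m K hd hL) 0 => Dop p.1 (WithLp.ofLp A) p.2) +
            50 * dP * α₂ ^ 3 + 10 * dP * α₀ * α₂ →
          nB ≤ 2 * dP * LP * α₁ + C₂ * α₂ ^ 2 →
          36 * dP * (KL * ((B₀ * Amaj + 1) * (1 + 2 * b₁))) * α₂ ≤ 1 / 2 → 50 * dP * α₂ ≤ 1 →
          2 * α₂ ^ 2 + 20 * dP * α₀ * α₂ + 2 * C₂ * α₂ ^ 2 ≤ α₀ + α₁ →
          msup (ℓ + 1) k |cf|⁻¹ (-1) (fun j (b : PBond (PV d ℓ m K hd hL) 0) => j ≤ (blkV1 hN D b).1.1) (WithLp.ofLp A) ≤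
              5 * dP * LP * (KL * ((B₀ * Amaj + 1) * (1 + 2 * b₁))) * (α₀ + α₁) ∧
            msup (ℓ + 1) k |cf|⁻¹ (-2) (fun j (p : Fin (d + 1) × PBond (PV d ℓ m K hd hL) 0) => j ≤ (blkV1 hN D p.2).1.1)
                (fun p : Fin (d + 1) × PBond (PV d ℓ m K hd hL) 0 => Dop p.1 (WithLp.ofLp A) p.2) ≤
              5 * dP * LP * (KL * ((B₀ * Amaj + 1) * (1 + 2 * b₁))) * (α₀ + α₁) ∧
            nJ ≤ 5 * dP * LP * (KL * ((B₀ * Amaj + 1) * (1 + 2 * b₁))) * (α₀ + α₁) ∧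
            msup (ℓ + 1) k |cf|⁻¹ (-3) (fun j (b : PBond (PV d ℓ m K hd hL) 0) => j ≤ (blkV1 hN D b).1.1)
                (fun b : PBond (PV d ℓ m K hd hL) 0 => laplace cf (fun z => A ⟨z, b.dir⟩) b.src) ≤
              5 * dP * LP * (KL * ((B₀ * Amaj + 1) * (1 + 2 * b₁))) * (α₀ + α₁) ∧
            (∀ b : PBond (PV d ℓ m K hd hL) 0,
              |WithLp.ofLp A b| ≤ 5 * dP * LP * (KL * ((B₀ * Amaj + 1) * (1 + 2 * b₁))) * (α₀ + α₁) *
                (((geomT D).len (blkV1 hN D b) * |cf|⁻¹) ^ 1)⁻¹) ∧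
            (∀ (ν : Fin (d + 1)) (b : PBond (PV d ℓ m K hd hL) 0),
              |Dop ν (WithLp.ofLp A) b| ≤ 5 * dP * LP * (KL * ((B₀ * Amaj + 1) * (1 + 2 * b₁))) * (α₀ + α₁) *
                (((geomT D).len (blkV1 hN D b) * |cf|⁻¹) ^ 2)⁻¹) ∧
            (∀ b : PBond (PV d ℓ m K hd hL) 0,
              |laplace cf (fun z => A ⟨z, b.dir⟩) b.src| ≤ 5 * dP * LP * (KL * ((B₀ * Amaj + 1) * (1 + 2 * b₁))) * (α₀ + α₁) *
                (((geomT D).len (blkV1 hN D b) * |cf|⁻¹) ^ 3)⁻¹) := by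
  -- r03's rate `σ` for the band `[b₀, b₁]`
  obtain ⟨σ, hσ, h26⟩ := prop26_2136_kLevel_assembly d ℓ hd hL hb₀ hb₁
  refine ⟨σ, hσ, fun α hα0 hα1 => ?_⟩
  -- the decay rate of the delivered majorant, `δ₃ = (1 − α)σ > 0`, and this lineage's constants at that rate
  have hσ' : 0 < delta3 α (2 * σ) := delta3_pos hα1 (by positivity)
  obtain ⟨B₀, KL, M₃, N₁, hB₀, hKL, hM₃, hN₁, hS⟩ := prop3_multiLevelTorus_V1_pref_vecLap d ℓ hd hL hσ'
  refine ⟨B₀, KL, M₃, N₁, hB₀, hKL, hM₃, hN₁, fun N₀ hN₀ Nbig s₁ s₂ CD cD hs₁ hs₂ hCD hcD => ?_⟩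
  -- r03's constants `A, M₁`
  obtain ⟨Amaj, M₁, hA, hM₁, hG26⟩ := h26 α hα0 hα1.le N₀ hN₀ Nbig hs₁ hs₂ hCD hcD
  refine ⟨Amaj, M₁, hA, hM₁, ?_⟩
  intro m K Mh k R P' hN D hk hk2 a hMha hM8 hR2 hP5 hℓ4 hpl hM1t hM3t hN0t hN1t hbud cf hcf w hw hwb hNbig hOut hcf1 hcf2 hc01 hc02 hline3
    Dop hD A J B h55 h42 h56 nJ nB hnJ hnB hJ hB dP LP C₂ α₀ α₁ α₂ hdP hdL hα₀ hα₁ hα₂ h55s h56s hside h50 h61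
  -- slot 1 = r03's conclusion, literally
  have hG := hG26 m K hN D hk hk2 hMha hM8 hR2 hP5 hℓ4 hpl hM1t hN0t hbud hcf hw hwb hNbig hOut hcf1 hcf2 hc01 hc02 hline3
  -- r03's thresholds imply this lineage's
  have hMh1 : 1 ≤ Mh := le_trans (by norm_num) hM8
  have hR2' : 2 * (ℓ + 1) ≤ R := by
    have h1 : ℓ + 1 ≤ (ℓ + 1) ^ 2 := by nlinarith
    exact le_trans (Nat.mul_le_mul_left 2 h1) hR2
  have hP4 : ∀ μ, 4 ≤ P' μ := fun μ => le_trans (by norm_num) (hP5 μ)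
  exact hS k Mh R hMh1 hN1t hR2' hM3t P' hP4 D m K hN hk cf hcf w hw b₀ b₁ hb₀.le (hb₀.le.trans hb₁) hwb Amaj hA Dop hG hD
    A J B h55 h42 h56 nJ nB hnJ hnB hJ hB dP LP C₂ α₀ α₁ α₂ hdP hdL hα₀ hα₁ hα₂ h55s h56s hside h50 h61


open Classical in
/-- **THE SAME WITH r03's INPUT (i) DISCHARGED** — the `□̃` overlap count holds with `Nbig = 3·9^{d+1}` on every admissible torus (p21/r03's
`B6Cover236QbigOverlapV1.card_filter_mem_QbigT_le`, p359412; r03's own `prop26_2136_kLevel_assembly_nbig` is the B6-side twin): PROPOSITION 3 at `U₀ = 1`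
on the `k`-level V1 torus modulo the THREE per-cube inputs (ii) `OutLoc (M_□h_□) □̃`, (iii) line-1 coefficient sizes/supports, (iv) line 3, the slot-2
majorants and the B8-side hypotheses; constants and thresholds as in `prop3_multiLevelTorus_V1_P26`. [cite: Balaban1985RegularSpaces, Prop. 3 p.87, (1.59) p.86; Balaban1984PropagatorsII, Prop. 2.6 (2.136) p.247, (2.36) p.229] -/
theorem prop3_multiLevelTorus_V1_P26_nbig (d ℓ : ℕ) (hd : 1 ≤ d + 1) (hL : Odd (ℓ + 1) ∧ 1 < ℓ + 1) {b₀ b₁ : ℝ} (hb₀ : 0 < b₀) (hb₁ : b₀ ≤ b₁) :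
    ∃ σ : ℝ, 0 < σ ∧ ∀ (α : ℝ), 0 ≤ α → α < 1 →
    ∃ B₀ KL M₃ : ℝ, ∃ N₁ : ℕ, 1 ≤ B₀ ∧ 1 ≤ KL ∧ 0 < M₃ ∧ 0 < N₁ ∧
    ∀ (N₀ : ℕ), 0 < N₀ → ∀ {s₁ s₂ CD cD : ℝ}, 0 ≤ s₁ → 0 ≤ s₂ → 0 ≤ CD → 0 < cD →
    ∃ Amaj M₁ : ℝ, 0 ≤ Amaj ∧ 0 < M₁ ∧
    ∀ (m K : ℕ) {Mh k R : ℕ} {P' : Fin (d + 1) → ℕ}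
      (hN : ∀ μ, N0 ℓ Mh k P' μ = (PV d ℓ m K hd hL).sitesPerDir 0) (D : TDomains d ℓ Mh k P' R) (hk : k ≤ m + K) (_ : 2 ≤ k)
      {a : ℕ} (hMha : Mh = (ℓ + 1) ^ a) (hM8 : 8 ≤ Mh) (_ : 2 * (ℓ + 1) ^ 2 ≤ R) (hP5 : ∀ μ, 5 ≤ P' μ) (_ : 4 ≤ ℓ)
      (hpl : ∀ c : ↥(cubes D.toDomains), Placed ℓ k P' c.1)
      (_ : M₁ ≤ ((ℓ : ℝ) + 1) * Mh) (_ : M₃ ≤ ((ℓ : ℝ) + 1) * Mh) (_ : N₀ + 1 ≤ R * ((ℓ + 1) * Mh)) (_ : N₁ + 1 ≤ R * ((ℓ + 1) * Mh))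
      (_ : Real.exp (-(α * σ)) * ((ℓ : ℝ) + 1) ^ ((2 * (d + 1 : ℕ) : ℝ) / N₀) < 1)
      {cf : ℝ} (hcf : cf ≠ 0) {w : BondIdx (domT hN D hk) → ℝ} (hw : ∀ i, 0 < w i) (_ : GlobalBand b₀ b₁ cf w)
      -- (ii): the output localisation of `M_□h_□` (p38) — (i) is discharged (`card_filter_mem_QbigT_le`, `Nbig = 3·9^{d+1}`)
      (_ : ∀ c : ↥(cubes D.toDomains), OutLoc (g := geomT D) (blkV1 hN D)
        (Ml hN hk (one_le_of_eight_le hM8) (four_le_of_five_le hP5) hMha c (band_le (d := d) (ℓ := ℓ) hb₀ hb₁) (hpl c) w cf * mulOp (hB hN D c))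
        (SbigT D (one_le_of_eight_le hM8) (four_le_of_five_le hP5) c))
      -- (iii): the line-1 coefficients, sizes and supports (p38)
      (_ : ∀ (c : ↥(cubes D.toDomains)) (e : Fin (d + 1) × Bool) (x : PBond (PV d ℓ m K hd hL) 0),
        |cfC hN hk (one_le_of_eight_le hM8) (four_le_of_five_le hP5) hMha c (band_le (d := d) (ℓ := ℓ) hb₀ hb₁) (hpl c) w cf e x| ≤
          s₁ * cf ^ 2 / ((geomTB D).M * (geomTB D).len (blkV1 hN D x) ^ 2))
      (_ : ∀ (c : ↥(cubes D.toDomains)) (e : Fin (d + 1) × Bool) (x : PBond (PV d ℓ m K hd hL) 0),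
        cfC hN hk (one_le_of_eight_le hM8) (four_le_of_five_le hP5) hMha c (band_le (d := d) (ℓ := ℓ) hb₀ hb₁) (hpl c) w cf e x ≠ 0 →
          blkV1 hN D x ∈ ST D (one_le_of_eight_le hM8) (four_le_of_five_le hP5) c)
      (_ : ∀ (c : ↥(cubes D.toDomains)) (x : PBond (PV d ℓ m K hd hL) 0),
        |c0C hN hk (one_le_of_eight_le hM8) (four_le_of_five_le hP5) hMha c (band_le (d := d) (ℓ := ℓ) hb₀ hb₁) (hpl c) w cf x| ≤
          s₂ * cf ^ 2 / ((geomTB D).M * (geomTB D).len (blkV1 hN D x) ^ 2))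
      (_ : ∀ (c : ↥(cubes D.toDomains)) (x : PBond (PV d ℓ m K hd hL) 0),
        c0C hN hk (one_le_of_eight_le hM8) (four_le_of_five_le hP5) hMha c (band_le (d := d) (ℓ := ℓ) hb₀ hb₁) (hpl c) w cf x ≠ 0 →
          blkV1 hN D x ∈ ST D (one_le_of_eight_le hM8) (four_le_of_five_le hP5) c)
      -- (iv): line 3 (p38/p22)
      (_ : ∀ c : ↥(cubes D.toDomains), HasMajorant (g := geomTB D) (blkV1 hN D)
        (mulOp (zB hN D (one_le_of_eight_le hM8) (four_le_of_five_le hP5) c) *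
          (onFun (dE (P := PV d ℓ m K hd hL) cf ∘ₗ (LinearMap.id - RE (domT hN D hk) cf) ∘ₗ dsE cf) -
            Pl hN hk (one_le_of_eight_le hM8) (four_le_of_five_le hP5) hMha c (band_le (d := d) (ℓ := ℓ) hb₀ hb₁) (hpl c) w cf) *
          mulOp (hB hN D c))
        (fun y y'' => CD * cf ^ 2 * Real.exp (-(cD * (geomTB D).M)) / (geomTB D).len y ^ 2 * Real.exp (-((2 * σ) * (geomTB D).dist y y''))))
      -- slot 2: the (2.136)₂-shape majorants of `∇G(1)` for the abstract first-order `Dop ν` (no k-level producer yet)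
      (Dop : Fin (d + 1) → Module.End ℝ (PBond (PV d ℓ m K hd hL) 0 → ℝ)),
      (∀ ν, HasMajorant (g := geomT D) (blkV1 hN D) (Dop ν ∘ₗ onFun (GE (domT hN D hk) hcf hw))
        (fun y y' => Amaj * ((geomT D).len y * |cf|⁻¹) * Real.exp (-(delta3 α (2 * σ) * (geomT D).dist y y')))) →
      ∀ (A J : BondSpace (PV d ℓ m K hd hL)) (B : BondIdxSpace (domT hN D hk)),
        dcsE cf (dcE cf A) = J → RE (domT hN D hk) cf (dsE cf A) = 0 → QE (domT hN D hk) A = B →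
        ∀ (nJ nB : ℝ), 0 ≤ nJ → 0 ≤ nB →
          (∀ b, |J b| ≤ nJ * (((geomT D).len (blkV1 hN D b) * |cf|⁻¹) ^ 3)⁻¹) →
          (∀ i, |B i| ≤ nB * (((ℓ : ℝ) + 1) ^ (i.1.1 : ℕ) * |cf|⁻¹)⁻¹) →
        ∀ (dP LP C₂ α₀ α₁ α₂ : ℝ), 0 ≤ dP → 1 ≤ dP * LP → 0 ≤ α₀ → 0 ≤ α₁ → 0 ≤ α₂ →
          nJ ≤ 2 * α₀ + 36 * dP * α₂ *
              msup (ℓ + 1) k |cf|⁻¹ (-2) (fun j (p : Fin (d + 1) × PBond (PV d ℓ m K hd hL) 0) => j ≤ (blkV1 hN D p.2).1.1)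
                (fun p : Fin (d + 1) × PBond (PV d ℓ m K hd hL) 0 => Dop p.1 (WithLp.ofLp A) p.2) +
            50 * dP * α₂ ^ 3 + 10 * dP * α₀ * α₂ →
          nB ≤ 2 * dP * LP * α₁ + C₂ * α₂ ^ 2 →
          36 * dP * (KL * ((B₀ * Amaj + 1) * (1 + 2 * b₁))) * α₂ ≤ 1 / 2 → 50 * dP * α₂ ≤ 1 →
          2 * α₂ ^ 2 + 20 * dP * α₀ * α₂ + 2 * C₂ * α₂ ^ 2 ≤ α₀ + α₁ →
          msup (ℓ + 1) k |cf|⁻¹ (-1) (fun j (b : PBond (PV d ℓ m K hd hL) 0) => j ≤ (blkV1 hN D b).1.1) (WithLp.ofLp A) ≤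
              5 * dP * LP * (KL * ((B₀ * Amaj + 1) * (1 + 2 * b₁))) * (α₀ + α₁) ∧
            msup (ℓ + 1) k |cf|⁻¹ (-2) (fun j (p : Fin (d + 1) × PBond (PV d ℓ m K hd hL) 0) => j ≤ (blkV1 hN D p.2).1.1)
                (fun p : Fin (d + 1) × PBond (PV d ℓ m K hd hL) 0 => Dop p.1 (WithLp.ofLp A) p.2) ≤
              5 * dP * LP * (KL * ((B₀ * Amaj + 1) * (1 + 2 * b₁))) * (α₀ + α₁) ∧
            nJ ≤ 5 * dP * LP * (KL * ((B₀ * Amaj + 1) * (1 + 2 * b₁))) * (α₀ + α₁) ∧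
            msup (ℓ + 1) k |cf|⁻¹ (-3) (fun j (b : PBond (PV d ℓ m K hd hL) 0) => j ≤ (blkV1 hN D b).1.1)
                (fun b : PBond (PV d ℓ m K hd hL) 0 => laplace cf (fun z => A ⟨z, b.dir⟩) b.src) ≤
              5 * dP * LP * (KL * ((B₀ * Amaj + 1) * (1 + 2 * b₁))) * (α₀ + α₁) ∧
            (∀ b : PBond (PV d ℓ m K hd hL) 0,
              |WithLp.ofLp A b| ≤ 5 * dP * LP * (KL * ((B₀ * Amaj + 1) * (1 + 2 * b₁))) * (α₀ + α₁) *
                (((geomT D).len (blkV1 hN D b) * |cf|⁻¹) ^ 1)⁻¹) ∧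
            (∀ (ν : Fin (d + 1)) (b : PBond (PV d ℓ m K hd hL) 0),
              |Dop ν (WithLp.ofLp A) b| ≤ 5 * dP * LP * (KL * ((B₀ * Amaj + 1) * (1 + 2 * b₁))) * (α₀ + α₁) *
                (((geomT D).len (blkV1 hN D b) * |cf|⁻¹) ^ 2)⁻¹) ∧
            (∀ b : PBond (PV d ℓ m K hd hL) 0,
              |laplace cf (fun z => A ⟨z, b.dir⟩) b.src| ≤ 5 * dP * LP * (KL * ((B₀ * Amaj + 1) * (1 + 2 * b₁))) * (α₀ + α₁) *
                (((geomT D).len (blkV1 hN D b) * |cf|⁻¹) ^ 3)⁻¹)   := by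
  obtain ⟨σ, hσ, h⟩ := prop3_multiLevelTorus_V1_P26 d ℓ hd hL hb₀ hb₁
  refine ⟨σ, hσ, fun α hα0 hα1 => ?_⟩
  obtain ⟨B₀, KL, M₃, N₁, hB₀, hKL, hM₃, hN₁, h1⟩ := h α hα0 hα1
  refine ⟨B₀, KL, M₃, N₁, hB₀, hKL, hM₃, hN₁, fun N₀ hN₀ s₁ s₂ CD cD hs₁ hs₂ hCD hcD => ?_⟩
  obtain ⟨Amaj, M₁, hA, hM₁, h2⟩ := h1 N₀ hN₀ (3 * 9 ^ (d + 1)) hs₁ hs₂ hCD hcD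
  refine ⟨Amaj, M₁, hA, hM₁, ?_⟩
  intro m K Mh k R P' hN D hk hk2 a hMha hM8 hR2 hP5 hℓ4 hpl hM1t hM3t hN0t hN1t hbud cf hcf w hw hwb hOut hcf1 hcf2 hc01 hc02 hline3
  exact h2 m K hN D hk hk2 hMha hM8 hR2 hP5 hℓ4 hpl hM1t hM3t hN0t hN1t hbud hcf hw hwb
    (card_filter_mem_QbigT_le D hL (le_trans (by norm_num) hM8) hR2 (one_le_of_eight_le hM8) (four_le_of_five_le hP5))
    hOut hcf1 hcf2 hc01 hc02 hline3


/-! ## §2  (v1.1) Inputs (i)–(iii) DISCHARGED: only line 3 displayed — slot 1 fed by p38's `prop26_2136_kLevel_assembly_line3` -/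

open Classical in
/-- **[B8] PROPOSITION 3 AT `U₀ = 1` ON THE `k`-LEVEL V1 TORUS — OF r03's FOUR PER-CUBE INPUTS ONLY LINE 3 LEFT** (v1.1).  Slot 1 of
`B8Prop3MultiLevelTorusLap.prop3_multiLevelTorus_V1_pref_vecLap` FED BY p38 g29's `B6Prop26KLevelAssemblyV1PerCube.prop26_2136_kLevel_assembly_line3`
(= r03's `k`-level assembly of [B6] Prop. 2.6 (2.136)₁ for the genuine `G(1) = Δ_a⁻¹` with (i) the `□̃` overlap count (`Nbig = 3·9^{d+1}`,
`B6Cover236QbigOverlapV1.card_filter_mem_QbigT_le`), (ii) the output localisation `OutLoc (M_□h_□) □̃` (`B6CubeMoutV1.outLoc_Ml_hB'`, p. 247 *"these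
functions have supports in □̃"* as ATTRIBUTED there — ref-4 D-g67-1 notes the sentence is not on p. 247; Lean content unaffected) and (iii) the line-1
coefficient sizes/supports (`B6CubeCoeffSizesV1.abs_cfC_le`/`cfC_supp`/`abs_c0C_le`/`c0C_supp`, p. 247 *"|∂h_□| ≤ O(1)(ML^jη)^{−1}, |Δh_□| ≤
O(1)M^{−1}(L^jη)^{−2}"*) DISCHARGED INSIDE).  Hence: for the weight band `0 < b₀ ≤ b₁` there is `σ > 0` such that for every budget `α ∈ [0, 1)` there are
`B₀ ≥ 1`, `K_L ≥ 1`, `M₃ > 0`, `N₁ ≥ 1` (on `d, L, (1 − α)σ`) such that for all `N₀ ≥ 1` and line-3 constants `C_D ≥ 0`, `c_D > 0` there are `A ≥ 0`, `M₁ > 0`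
such that on every admissible `k`-level V1 torus (`k ≥ 2`, `M_h = Lᵃ ≥ 8`, `R ≥ 2L²`, `P′ ≥ 5`, `L ≥ 5`, cubes `Placed`, `M₁, M₃ ≤ L·M_h`, `N₀ + 1, N₁ + 1 ≤
R·L·M_h`, `e^{−ασ}L^{2(d+1)/N₀} < 1`), for `c′ ≠ 0` and weights in `GlobalBand b₀ b₁ c′ w`, GIVEN ONLY the line-3 majorant of `ζ_□(∂(1−R)∂* − P_□)h_□` at
rate `2σ` for every cube, the slot-2 majorants of `Dop ν ∘ onFun G(1)` (constant `A`, rate `(1 − α)σ`) and the B8-side hypotheses (1.55)/(1.42)/(1.56) +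
size lines: THE SEVEN CONCLUSIONS of Proposition 3 at `U₀ = 1` (p. 87 *"then U₁ satisfies (1.36)–(1.39) with B₁ = 5dLB₀, B₂(β₀) = 5dLB₀(β₀)"*; (1.59) p. 86
*"|A|₍₋₁₎, |∇^η_{U₀}A|₍₋₂₎, |D^{η*}_{U₀}D^η_{U₀}A|₍₋₃₎, |Δ^η_{U₀}A|₍₋₃₎ ≦ B₀(|J|₍₋₃₎ + |B₁|)"*) with `B₀′ = K_L(B₀A + 1)(1 + 2b₁)`.  Proof = plumbing, as
`prop3_multiLevelTorus_V1_P26` with p38's theorem in place of r03's. [cite: Balaban1985RegularSpaces, Prop. 3 p.87, (1.59)–(1.62) pp.86–87, (1.55)–(1.58) p.86, (1.42) p.84; Balaban1984PropagatorsII, Prop. 2.6 (2.136) p.247, (2.133)–(2.135) p.247, (2.92) p.239, (2.36) p.229; Balaban1985BackgroundPropagators, Theorem 3.3 p.399, (3.47) p.398] -/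
theorem prop3_multiLevelTorus_V1_P26_line3 (d ℓ : ℕ) (hd : 1 ≤ d + 1) (hL : Odd (ℓ + 1) ∧ 1 < ℓ + 1) {b₀ b₁ : ℝ} (hb₀ : 0 < b₀) (hb₁ : b₀ ≤ b₁) :
    ∃ σ : ℝ, 0 < σ ∧ ∀ (α : ℝ), 0 ≤ α → α < 1 →
    ∃ B₀ KL M₃ : ℝ, ∃ N₁ : ℕ, 1 ≤ B₀ ∧ 1 ≤ KL ∧ 0 < M₃ ∧ 0 < N₁ ∧
    ∀ (N₀ : ℕ), 0 < N₀ → ∀ {CD cD : ℝ}, 0 ≤ CD → 0 < cD →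
    ∃ Amaj M₁ : ℝ, 0 ≤ Amaj ∧ 0 < M₁ ∧
    ∀ (m K : ℕ) {Mh k R : ℕ} {P' : Fin (d + 1) → ℕ}
      (hN : ∀ μ, N0 ℓ Mh k P' μ = (PV d ℓ m K hd hL).sitesPerDir 0) (D : TDomains d ℓ Mh k P' R) (hk : k ≤ m + K) (_ : 2 ≤ k)
      {a : ℕ} (hMha : Mh = (ℓ + 1) ^ a) (hM8 : 8 ≤ Mh) (_ : 2 * (ℓ + 1) ^ 2 ≤ R) (hP5 : ∀ μ, 5 ≤ P' μ) (_ : 4 ≤ ℓ)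
      (hpl : ∀ c : ↥(cubes D.toDomains), Placed ℓ k P' c.1)
      (_ : M₁ ≤ ((ℓ : ℝ) + 1) * Mh) (_ : M₃ ≤ ((ℓ : ℝ) + 1) * Mh) (_ : N₀ + 1 ≤ R * ((ℓ + 1) * Mh)) (_ : N₁ + 1 ≤ R * ((ℓ + 1) * Mh))
      (_ : Real.exp (-(α * σ)) * ((ℓ : ℝ) + 1) ^ ((2 * (d + 1 : ℕ) : ℝ) / N₀) < 1)
      {cf : ℝ} (hcf : cf ≠ 0) {w : BondIdx (domT hN D hk) → ℝ} (hw : ∀ i, 0 < w i) (_ : GlobalBand b₀ b₁ cf w)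
      -- line 3 (p38/p22): the ONLY per-cube input left ((i) overlap count, (ii) `OutLoc (M_□h_□) □̃`, (iii) line-1 sizes/supports DISCHARGED)
      (_ : ∀ c : ↥(cubes D.toDomains), HasMajorant (g := geomTB D) (blkV1 hN D)
        (mulOp (zB hN D (one_le_of_eight_le hM8) (four_le_of_five_le hP5) c) *
          (onFun (dE (P := PV d ℓ m K hd hL) cf ∘ₗ (LinearMap.id - RE (domT hN D hk) cf) ∘ₗ dsE cf) -
            Pl hN hk (one_le_of_eight_le hM8) (four_le_of_five_le hP5) hMha c (band_le (d := d) (ℓ := ℓ) hb₀ hb₁) (hpl c) w cf) *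
          mulOp (hB hN D c))
        (fun y y'' => CD * cf ^ 2 * Real.exp (-(cD * (geomTB D).M)) / (geomTB D).len y ^ 2 * Real.exp (-((2 * σ) * (geomTB D).dist y y''))))
      -- slot 2: the (2.136)₂-shape majorants of `∇G(1)` for the abstract first-order `Dop ν` (no k-level producer yet)
      (Dop : Fin (d + 1) → Module.End ℝ (PBond (PV d ℓ m K hd hL) 0 → ℝ)),
      (∀ ν, HasMajorant (g := geomT D) (blkV1 hN D) (Dop ν ∘ₗ onFun (GE (domT hN D hk) hcf hw))
        (fun y y' => Amaj * ((geomT D).len y * |cf|⁻¹) * Real.exp (-(delta3 α (2 * σ) * (geomT D).dist y y')))) →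
      ∀ (A J : BondSpace (PV d ℓ m K hd hL)) (B : BondIdxSpace (domT hN D hk)),
        dcsE cf (dcE cf A) = J → RE (domT hN D hk) cf (dsE cf A) = 0 → QE (domT hN D hk) A = B →
        ∀ (nJ nB : ℝ), 0 ≤ nJ → 0 ≤ nB →
          (∀ b, |J b| ≤ nJ * (((geomT D).len (blkV1 hN D b) * |cf|⁻¹) ^ 3)⁻¹) →
          (∀ i, |B i| ≤ nB * (((ℓ : ℝ) + 1) ^ (i.1.1 : ℕ) * |cf|⁻¹)⁻¹) →
        ∀ (dP LP C₂ α₀ α₁ α₂ : ℝ), 0 ≤ dP → 1 ≤ dP * LP → 0 ≤ α₀ → 0 ≤ α₁ → 0 ≤ α₂ →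
          nJ ≤ 2 * α₀ + 36 * dP * α₂ *
              msup (ℓ + 1) k |cf|⁻¹ (-2) (fun j (p : Fin (d + 1) × PBond (PV d ℓ m K hd hL) 0) => j ≤ (blkV1 hN D p.2).1.1)
                (fun p : Fin (d + 1) × PBond (PV d ℓ m K hd hL) 0 => Dop p.1 (WithLp.ofLp A) p.2) +
            50 * dP * α₂ ^ 3 + 10 * dP * α₀ * α₂ →
          nB ≤ 2 * dP * LP * α₁ + C₂ * α₂ ^ 2 →
          36 * dP * (KL * ((B₀ * Amaj + 1) * (1 + 2 * b₁))) * α₂ ≤ 1 / 2 → 50 * dP * α₂ ≤ 1 →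
          2 * α₂ ^ 2 + 20 * dP * α₀ * α₂ + 2 * C₂ * α₂ ^ 2 ≤ α₀ + α₁ →
          msup (ℓ + 1) k |cf|⁻¹ (-1) (fun j (b : PBond (PV d ℓ m K hd hL) 0) => j ≤ (blkV1 hN D b).1.1) (WithLp.ofLp A) ≤
              5 * dP * LP * (KL * ((B₀ * Amaj + 1) * (1 + 2 * b₁))) * (α₀ + α₁) ∧
            msup (ℓ + 1) k |cf|⁻¹ (-2) (fun j (p : Fin (d + 1) × PBond (PV d ℓ m K hd hL) 0) => j ≤ (blkV1 hN D p.2).1.1)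
                (fun p : Fin (d + 1) × PBond (PV d ℓ m K hd hL) 0 => Dop p.1 (WithLp.ofLp A) p.2) ≤
              5 * dP * LP * (KL * ((B₀ * Amaj + 1) * (1 + 2 * b₁))) * (α₀ + α₁) ∧
            nJ ≤ 5 * dP * LP * (KL * ((B₀ * Amaj + 1) * (1 + 2 * b₁))) * (α₀ + α₁) ∧
            msup (ℓ + 1) k |cf|⁻¹ (-3) (fun j (b : PBond (PV d ℓ m K hd hL) 0) => j ≤ (blkV1 hN D b).1.1)
                (fun b : PBond (PV d ℓ m K hd hL) 0 => laplace cf (fun z => A ⟨z, b.dir⟩) b.src) ≤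
              5 * dP * LP * (KL * ((B₀ * Amaj + 1) * (1 + 2 * b₁))) * (α₀ + α₁) ∧
            (∀ b : PBond (PV d ℓ m K hd hL) 0,
              |WithLp.ofLp A b| ≤ 5 * dP * LP * (KL * ((B₀ * Amaj + 1) * (1 + 2 * b₁))) * (α₀ + α₁) *
                (((geomT D).len (blkV1 hN D b) * |cf|⁻¹) ^ 1)⁻¹) ∧
            (∀ (ν : Fin (d + 1)) (b : PBond (PV d ℓ m K hd hL) 0),
              |Dop ν (WithLp.ofLp A) b| ≤ 5 * dP * LP * (KL * ((B₀ * Amaj + 1) * (1 + 2 * b₁))) * (α₀ + α₁) *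
                (((geomT D).len (blkV1 hN D b) * |cf|⁻¹) ^ 2)⁻¹) ∧
            (∀ b : PBond (PV d ℓ m K hd hL) 0,
              |laplace cf (fun z => A ⟨z, b.dir⟩) b.src| ≤ 5 * dP * LP * (KL * ((B₀ * Amaj + 1) * (1 + 2 * b₁))) * (α₀ + α₁) *
                (((geomT D).len (blkV1 hN D b) * |cf|⁻¹) ^ 3)⁻¹) := by
  -- p38's `σ` (= r03's) for the band `[b₀, b₁]`
  obtain ⟨σ, hσ, h26⟩ := prop26_2136_kLevel_assembly_line3 d ℓ hd hL hb₀ hb₁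
  refine ⟨σ, hσ, fun α hα0 hα1 => ?_⟩
  -- the decay rate of the delivered majorant and this lineage's constants at that rate
  have hσ' : 0 < delta3 α (2 * σ) := delta3_pos hα1 (by positivity)
  obtain ⟨B₀, KL, M₃, N₁, hB₀, hKL, hM₃, hN₁, hS⟩ := prop3_multiLevelTorus_V1_pref_vecLap d ℓ hd hL hσ'
  refine ⟨B₀, KL, M₃, N₁, hB₀, hKL, hM₃, hN₁, fun N₀ hN₀ CD cD hCD hcD => ?_⟩
  -- the assembly's constants `A, M₁`
  obtain ⟨Amaj, M₁, hA, hM₁, hG26⟩ := h26 α hα0 hα1.le N₀ hN₀ hCD hcD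
  refine ⟨Amaj, M₁, hA, hM₁, ?_⟩
  intro m K Mh k R P' hN D hk hk2 a hMha hM8 hR2 hP5 hℓ4 hpl hM1t hM3t hN0t hN1t hbud cf hcf w hw hwb hline3
    Dop hD A J B h55 h42 h56 nJ nB hnJ hnB hJ hB dP LP C₂ α₀ α₁ α₂ hdP hdL hα₀ hα₁ hα₂ h55s h56s hside h50 h61
  -- slot 1 = p38's conclusion, literally
  have hG := hG26 m K hN D hk hk2 hMha hM8 hR2 hP5 hℓ4 hpl hM1t hN0t hbud hcf hw hwb hline3
  -- the assembly's thresholds imply this lineage's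
  have hMh1 : 1 ≤ Mh := le_trans (by norm_num) hM8
  have hR2' : 2 * (ℓ + 1) ≤ R := by
    have h1 : ℓ + 1 ≤ (ℓ + 1) ^ 2 := by nlinarith
    exact le_trans (Nat.mul_le_mul_left 2 h1) hR2
  have hP4 : ∀ μ, 4 ≤ P' μ := fun μ => le_trans (by norm_num) (hP5 μ)
  exact hS k Mh R hMh1 hN1t hR2' hM3t P' hP4 D m K hN hk cf hcf w hw b₀ b₁ hb₀.le (hb₀.le.trans hb₁) hwb Amaj hA Dop hG hD
    A J B h55 h42 h56 nJ nB hnJ hnB hJ hB dP LP C₂ α₀ α₁ α₂ hdP hdL hα₀ hα₁ hα₂ h55s h56s hside h50 h61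


/-! ## §3  (v1.1) The rate as a PARAMETER (`0 < σ ≤ σ₀`) — slot 1 fed by r03's `prop26_2136_kLevel_final_le` -/

open Classical in
/-- **THE SAME WITH THE RATE AS A PARAMETER — ANY `0 < σ ≤ σ₀`** (v1.1).  Slot 1 fed by r03 g21's `B6Prop26KLevelAssemblyV1.prop26_2136_kLevel_final_le`
(v1.4, p361529: the whole `k`-level assembly re-proved with every (2.134) input weakened to the rate `2σ`, (i)–(iii) discharged inside, only line 3
displayed).  POINT (r03's HOME/INBOX line 2026-08-23T10:28:18Z): a line-3 majorant proved by p38/p22 at ITS OWN rate `ρ₃` is consumed here at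
`σ := min σ₀ (ρ₃/2)` — monotonicity `e^{−ρ₃d} ≤ e^{−2σd}` of the consumer's majorant (`B6RandomWalk.hasMajorant_mono`) — WITHOUT re-opening r03's
assembly, this lineage's socket, or this file; the B8 constants `B₀, K_L, M₃, N₁` are then read at the rate `(1 − α)σ`.  Statement = `prop3_multiLevelTorus_V1_P26_line3`
with the prefix `∃ σ₀ > 0, ∀ σ ∈ (0, σ₀], ∀ α ∈ [0, 1), …`. [cite: Balaban1985RegularSpaces, Prop. 3 p.87, (1.59) p.86; Balaban1984PropagatorsII, Prop. 2.6 (2.136) p.247, (2.92) p.239, (2.133)–(2.135) p.247] -/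
theorem prop3_multiLevelTorus_V1_P26_line3_le (d ℓ : ℕ) (hd : 1 ≤ d + 1) (hL : Odd (ℓ + 1) ∧ 1 < ℓ + 1) {b₀ b₁ : ℝ} (hb₀ : 0 < b₀) (hb₁ : b₀ ≤ b₁) :
    ∃ σ₀ : ℝ, 0 < σ₀ ∧ ∀ (σ : ℝ), 0 < σ → σ ≤ σ₀ → ∀ (α : ℝ), 0 ≤ α → α < 1 →
    ∃ B₀ KL M₃ : ℝ, ∃ N₁ : ℕ, 1 ≤ B₀ ∧ 1 ≤ KL ∧ 0 < M₃ ∧ 0 < N₁ ∧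
    ∀ (N₀ : ℕ), 0 < N₀ → ∀ {CD cD : ℝ}, 0 ≤ CD → 0 < cD →
    ∃ Amaj M₁ : ℝ, 0 ≤ Amaj ∧ 0 < M₁ ∧
    ∀ (m K : ℕ) {Mh k R : ℕ} {P' : Fin (d + 1) → ℕ}
      (hN : ∀ μ, N0 ℓ Mh k P' μ = (PV d ℓ m K hd hL).sitesPerDir 0) (D : TDomains d ℓ Mh k P' R) (hk : k ≤ m + K) (_ : 2 ≤ k)
      {a : ℕ} (hMha : Mh = (ℓ + 1) ^ a) (hM8 : 8 ≤ Mh) (_ : 2 * (ℓ + 1) ^ 2 ≤ R) (hP5 : ∀ μ, 5 ≤ P' μ) (_ : 4 ≤ ℓ)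
      (hpl : ∀ c : ↥(cubes D.toDomains), Placed ℓ k P' c.1)
      (_ : M₁ ≤ ((ℓ : ℝ) + 1) * Mh) (_ : M₃ ≤ ((ℓ : ℝ) + 1) * Mh) (_ : N₀ + 1 ≤ R * ((ℓ + 1) * Mh)) (_ : N₁ + 1 ≤ R * ((ℓ + 1) * Mh))
      (_ : Real.exp (-(α * σ)) * ((ℓ : ℝ) + 1) ^ ((2 * (d + 1 : ℕ) : ℝ) / N₀) < 1)
      {cf : ℝ} (hcf : cf ≠ 0) {w : BondIdx (domT hN D hk) → ℝ} (hw : ∀ i, 0 < w i) (_ : GlobalBand b₀ b₁ cf w)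
      -- line 3 (p38/p22) AT THE CHOSEN RATE `2σ`, any `0 < σ ≤ σ₀`
      (_ : ∀ c : ↥(cubes D.toDomains), HasMajorant (g := geomTB D) (blkV1 hN D)
        (mulOp (zB hN D (one_le_of_eight_le hM8) (four_le_of_five_le hP5) c) *
          (onFun (dE (P := PV d ℓ m K hd hL) cf ∘ₗ (LinearMap.id - RE (domT hN D hk) cf) ∘ₗ dsE cf) -
            Pl hN hk (one_le_of_eight_le hM8) (four_le_of_five_le hP5) hMha c (band_le (d := d) (ℓ := ℓ) hb₀ hb₁) (hpl c) w cf) *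
          mulOp (hB hN D c))
        (fun y y'' => CD * cf ^ 2 * Real.exp (-(cD * (geomTB D).M)) / (geomTB D).len y ^ 2 * Real.exp (-((2 * σ) * (geomTB D).dist y y''))))
      -- slot 2: the (2.136)₂-shape majorants of `∇G(1)` for the abstract first-order `Dop ν` (no k-level producer yet)
      (Dop : Fin (d + 1) → Module.End ℝ (PBond (PV d ℓ m K hd hL) 0 → ℝ)),
      (∀ ν, HasMajorant (g := geomT D) (blkV1 hN D) (Dop ν ∘ₗ onFun (GE (domT hN D hk) hcf hw))
        (fun y y' => Amaj * ((geomT D).len y * |cf|⁻¹) * Real.exp (-(delta3 α (2 * σ) * (geomT D).dist y y')))) →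
      ∀ (A J : BondSpace (PV d ℓ m K hd hL)) (B : BondIdxSpace (domT hN D hk)),
        dcsE cf (dcE cf A) = J → RE (domT hN D hk) cf (dsE cf A) = 0 → QE (domT hN D hk) A = B →
        ∀ (nJ nB : ℝ), 0 ≤ nJ → 0 ≤ nB →
          (∀ b, |J b| ≤ nJ * (((geomT D).len (blkV1 hN D b) * |cf|⁻¹) ^ 3)⁻¹) →
          (∀ i, |B i| ≤ nB * (((ℓ : ℝ) + 1) ^ (i.1.1 : ℕ) * |cf|⁻¹)⁻¹) →
        ∀ (dP LP C₂ α₀ α₁ α₂ : ℝ), 0 ≤ dP → 1 ≤ dP * LP → 0 ≤ α₀ → 0 ≤ α₁ → 0 ≤ α₂ →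
          nJ ≤ 2 * α₀ + 36 * dP * α₂ *
              msup (ℓ + 1) k |cf|⁻¹ (-2) (fun j (p : Fin (d + 1) × PBond (PV d ℓ m K hd hL) 0) => j ≤ (blkV1 hN D p.2).1.1)
                (fun p : Fin (d + 1) × PBond (PV d ℓ m K hd hL) 0 => Dop p.1 (WithLp.ofLp A) p.2) +
            50 * dP * α₂ ^ 3 + 10 * dP * α₀ * α₂ →
          nB ≤ 2 * dP * LP * α₁ + C₂ * α₂ ^ 2 →
          36 * dP * (KL * ((B₀ * Amaj + 1) * (1 + 2 * b₁))) * α₂ ≤ 1 / 2 → 50 * dP * α₂ ≤ 1 →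
          2 * α₂ ^ 2 + 20 * dP * α₀ * α₂ + 2 * C₂ * α₂ ^ 2 ≤ α₀ + α₁ →
          msup (ℓ + 1) k |cf|⁻¹ (-1) (fun j (b : PBond (PV d ℓ m K hd hL) 0) => j ≤ (blkV1 hN D b).1.1) (WithLp.ofLp A) ≤
              5 * dP * LP * (KL * ((B₀ * Amaj + 1) * (1 + 2 * b₁))) * (α₀ + α₁) ∧
            msup (ℓ + 1) k |cf|⁻¹ (-2) (fun j (p : Fin (d + 1) × PBond (PV d ℓ m K hd hL) 0) => j ≤ (blkV1 hN D p.2).1.1)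
                (fun p : Fin (d + 1) × PBond (PV d ℓ m K hd hL) 0 => Dop p.1 (WithLp.ofLp A) p.2) ≤
              5 * dP * LP * (KL * ((B₀ * Amaj + 1) * (1 + 2 * b₁))) * (α₀ + α₁) ∧
            nJ ≤ 5 * dP * LP * (KL * ((B₀ * Amaj + 1) * (1 + 2 * b₁))) * (α₀ + α₁) ∧
            msup (ℓ + 1) k |cf|⁻¹ (-3) (fun j (b : PBond (PV d ℓ m K hd hL) 0) => j ≤ (blkV1 hN D b).1.1)
                (fun b : PBond (PV d ℓ m K hd hL) 0 => laplace cf (fun z => A ⟨z, b.dir⟩) b.src) ≤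
              5 * dP * LP * (KL * ((B₀ * Amaj + 1) * (1 + 2 * b₁))) * (α₀ + α₁) ∧
            (∀ b : PBond (PV d ℓ m K hd hL) 0,
              |WithLp.ofLp A b| ≤ 5 * dP * LP * (KL * ((B₀ * Amaj + 1) * (1 + 2 * b₁))) * (α₀ + α₁) *
                (((geomT D).len (blkV1 hN D b) * |cf|⁻¹) ^ 1)⁻¹) ∧
            (∀ (ν : Fin (d + 1)) (b : PBond (PV d ℓ m K hd hL) 0),
              |Dop ν (WithLp.ofLp A) b| ≤ 5 * dP * LP * (KL * ((B₀ * Amaj + 1) * (1 + 2 * b₁))) * (α₀ + α₁) *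
                (((geomT D).len (blkV1 hN D b) * |cf|⁻¹) ^ 2)⁻¹) ∧
            (∀ b : PBond (PV d ℓ m K hd hL) 0,
              |laplace cf (fun z => A ⟨z, b.dir⟩) b.src| ≤ 5 * dP * LP * (KL * ((B₀ * Amaj + 1) * (1 + 2 * b₁))) * (α₀ + α₁) *
                (((geomT D).len (blkV1 hN D b) * |cf|⁻¹) ^ 3)⁻¹) := by
  -- r03's admissible range of rates `(0, σ₀]` for the band `[b₀, b₁]`
  obtain ⟨σ₀, hσ₀, h26⟩ := prop26_2136_kLevel_final_le d ℓ hd hL hb₀ hb₁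
  refine ⟨σ₀, hσ₀, fun σ hσ hσle α hα0 hα1 => ?_⟩
  -- the decay rate of the delivered majorant and this lineage's constants at that rate
  have hσ' : 0 < delta3 α (2 * σ) := delta3_pos hα1 (by positivity)
  obtain ⟨B₀, KL, M₃, N₁, hB₀, hKL, hM₃, hN₁, hS⟩ := prop3_multiLevelTorus_V1_pref_vecLap d ℓ hd hL hσ'
  refine ⟨B₀, KL, M₃, N₁, hB₀, hKL, hM₃, hN₁, fun N₀ hN₀ CD cD hCD hcD => ?_⟩
  -- the assembly's constants `A, M₁`
  obtain ⟨Amaj, M₁, hA, hM₁, hG26⟩ := h26 σ hσ hσle α hα0 hα1.le N₀ hN₀ hCD hcD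
  refine ⟨Amaj, M₁, hA, hM₁, ?_⟩
  intro m K Mh k R P' hN D hk hk2 a hMha hM8 hR2 hP5 hℓ4 hpl hM1t hM3t hN0t hN1t hbud cf hcf w hw hwb hline3
    Dop hD A J B h55 h42 h56 nJ nB hnJ hnB hJ hB dP LP C₂ α₀ α₁ α₂ hdP hdL hα₀ hα₁ hα₂ h55s h56s hside h50 h61
  -- slot 1 = r03's conclusion at the rate `2σ`, literally
  have hG := hG26 m K hN D hk hk2 hMha hM8 hR2 hP5 hℓ4 hpl hM1t hN0t hbud hcf hw hwb hline3
  -- the assembly's thresholds imply this lineage's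
  have hMh1 : 1 ≤ Mh := le_trans (by norm_num) hM8
  have hR2' : 2 * (ℓ + 1) ≤ R := by
    have h1 : ℓ + 1 ≤ (ℓ + 1) ^ 2 := by nlinarith
    exact le_trans (Nat.mul_le_mul_left 2 h1) hR2
  have hP4 : ∀ μ, 4 ≤ P' μ := fun μ => le_trans (by norm_num) (hP5 μ)
  exact hS k Mh R hMh1 hN1t hR2' hM3t P' hP4 D m K hN hk cf hcf w hw b₀ b₁ hb₀.le (hb₀.le.trans hb₁) hwb Amaj hA Dop hG hD
    A J B h55 h42 h56 nJ nB hnJ hnB hJ hB dP LP C₂ α₀ α₁ α₂ hdP hdL hα₀ hα₁ hα₂ h55s h56s hside h50 h61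


/-! ## §4  (v1.1) The regime `L = 5`, `P′ ≥ 12`: every cube placed — no geometric per-cube hypothesis left -/

open Classical in
/-- **THE SAME AT `L = 5` (`ℓ = 4`), `P′_μ ≥ 12`** (v1.1) — r03's canonical index-`2` chart places every cube (`B6CubeWindowV1.placed_all_cubes`; p38's
B6-side twin is `prop26_2136_kLevel_assembly_L5_line3`), so NO geometric per-cube hypothesis is left: Proposition 3 at `U₀ = 1` on the `k`-level V1 torus
with `L = 5` is displayed modulo the line-3 majorant, the Lemma-2.1 budget `(α, N₀)`, the slot-2 majorants of `∇G(1)` and the B8-side hypotheses only.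
Derived from `prop3_multiLevelTorus_V1_P26_line3` at `ℓ = 4` (`4 ≤ ℓ` by `le_rfl`, `5 ≤ P′` from `12 ≤ P′`). [cite: Balaban1985RegularSpaces, Prop. 3 p.87, (1.59) p.86; Balaban1984PropagatorsII, Prop. 2.6 (2.136) p.247, (2.36) p.229, p.235] -/
theorem prop3_multiLevelTorus_V1_P26_L5_line3 (d : ℕ) (hd : 1 ≤ d + 1) (hL : Odd (4 + 1) ∧ 1 < 4 + 1) {b₀ b₁ : ℝ} (hb₀ : 0 < b₀) (hb₁ : b₀ ≤ b₁) :
    ∃ σ : ℝ, 0 < σ ∧ ∀ (α : ℝ), 0 ≤ α → α < 1 →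
    ∃ B₀ KL M₃ : ℝ, ∃ N₁ : ℕ, 1 ≤ B₀ ∧ 1 ≤ KL ∧ 0 < M₃ ∧ 0 < N₁ ∧
    ∀ (N₀ : ℕ), 0 < N₀ → ∀ {CD cD : ℝ}, 0 ≤ CD → 0 < cD →
    ∃ Amaj M₁ : ℝ, 0 ≤ Amaj ∧ 0 < M₁ ∧
    ∀ (m K : ℕ) {Mh k R : ℕ} {P' : Fin (d + 1) → ℕ}
      (hN : ∀ μ, N0 4 Mh k P' μ = (PV d 4 m K hd hL).sitesPerDir 0) (D : TDomains d 4 Mh k P' R) (hk : k ≤ m + K) (_ : 2 ≤ k)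
      {a : ℕ} (hMha : Mh = (4 + 1) ^ a) (hM8 : 8 ≤ Mh) (_ : 2 * (4 + 1) ^ 2 ≤ R) (hP12 : ∀ μ, 12 ≤ P' μ)
      (_ : M₁ ≤ (((4 : ℕ) : ℝ) + 1) * Mh) (_ : M₃ ≤ (((4 : ℕ) : ℝ) + 1) * Mh) (_ : N₀ + 1 ≤ R * ((4 + 1) * Mh)) (_ : N₁ + 1 ≤ R * ((4 + 1) * Mh))
      (_ : Real.exp (-(α * σ)) * (((4 : ℕ) : ℝ) + 1) ^ ((2 * (d + 1 : ℕ) : ℝ) / N₀) < 1)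
      {cf : ℝ} (hcf : cf ≠ 0) {w : BondIdx (domT hN D hk) → ℝ} (hw : ∀ i, 0 < w i) (_ : GlobalBand b₀ b₁ cf w)
      -- line 3 (p38/p22): the only displayed per-cube input; the canonical chart places every cube (`placed_all_cubes`)
      (_ : ∀ c : ↥(cubes D.toDomains), HasMajorant (g := geomTB D) (blkV1 hN D)
        (mulOp (zB hN D (one_le_of_eight_le hM8) (four_le_of_five_le (fun μ => le_trans (by norm_num) (hP12 μ))) c) *
          (onFun (dE (P := PV d 4 m K hd hL) cf ∘ₗ (LinearMap.id - RE (domT hN D hk) cf) ∘ₗ dsE cf) -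
            Pl hN hk (one_le_of_eight_le hM8) (four_le_of_five_le (fun μ => le_trans (by norm_num) (hP12 μ))) hMha c (band_le (d := d) (ℓ := 4) hb₀ hb₁) (placed_all_cubes (D := D) rfl hP12 c) w cf) *
          mulOp (hB hN D c))
        (fun y y'' => CD * cf ^ 2 * Real.exp (-(cD * (geomTB D).M)) / (geomTB D).len y ^ 2 * Real.exp (-((2 * σ) * (geomTB D).dist y y''))))
      -- slot 2: the (2.136)₂-shape majorants of `∇G(1)` for the abstract first-order `Dop ν` (no k-level producer yet)
      (Dop : Fin (d + 1) → Module.End ℝ (PBond (PV d 4 m K hd hL) 0 → ℝ)),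
      (∀ ν, HasMajorant (g := geomT D) (blkV1 hN D) (Dop ν ∘ₗ onFun (GE (domT hN D hk) hcf hw))
        (fun y y' => Amaj * ((geomT D).len y * |cf|⁻¹) * Real.exp (-(delta3 α (2 * σ) * (geomT D).dist y y')))) →
      ∀ (A J : BondSpace (PV d 4 m K hd hL)) (B : BondIdxSpace (domT hN D hk)),
        dcsE cf (dcE cf A) = J → RE (domT hN D hk) cf (dsE cf A) = 0 → QE (domT hN D hk) A = B →
        ∀ (nJ nB : ℝ), 0 ≤ nJ → 0 ≤ nB →
          (∀ b, |J b| ≤ nJ * (((geomT D).len (blkV1 hN D b) * |cf|⁻¹) ^ 3)⁻¹) →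
          (∀ i, |B i| ≤ nB * ((((4 : ℕ) : ℝ) + 1) ^ (i.1.1 : ℕ) * |cf|⁻¹)⁻¹) →
        ∀ (dP LP C₂ α₀ α₁ α₂ : ℝ), 0 ≤ dP → 1 ≤ dP * LP → 0 ≤ α₀ → 0 ≤ α₁ → 0 ≤ α₂ →
          nJ ≤ 2 * α₀ + 36 * dP * α₂ *
              msup (4 + 1) k |cf|⁻¹ (-2) (fun j (p : Fin (d + 1) × PBond (PV d 4 m K hd hL) 0) => j ≤ (blkV1 hN D p.2).1.1)
                (fun p : Fin (d + 1) × PBond (PV d 4 m K hd hL) 0 => Dop p.1 (WithLp.ofLp A) p.2) +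
            50 * dP * α₂ ^ 3 + 10 * dP * α₀ * α₂ →
          nB ≤ 2 * dP * LP * α₁ + C₂ * α₂ ^ 2 →
          36 * dP * (KL * ((B₀ * Amaj + 1) * (1 + 2 * b₁))) * α₂ ≤ 1 / 2 → 50 * dP * α₂ ≤ 1 →
          2 * α₂ ^ 2 + 20 * dP * α₀ * α₂ + 2 * C₂ * α₂ ^ 2 ≤ α₀ + α₁ →
          msup (4 + 1) k |cf|⁻¹ (-1) (fun j (b : PBond (PV d 4 m K hd hL) 0) => j ≤ (blkV1 hN D b).1.1) (WithLp.ofLp A) ≤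
              5 * dP * LP * (KL * ((B₀ * Amaj + 1) * (1 + 2 * b₁))) * (α₀ + α₁) ∧
            msup (4 + 1) k |cf|⁻¹ (-2) (fun j (p : Fin (d + 1) × PBond (PV d 4 m K hd hL) 0) => j ≤ (blkV1 hN D p.2).1.1)
                (fun p : Fin (d + 1) × PBond (PV d 4 m K hd hL) 0 => Dop p.1 (WithLp.ofLp A) p.2) ≤
              5 * dP * LP * (KL * ((B₀ * Amaj + 1) * (1 + 2 * b₁))) * (α₀ + α₁) ∧
            nJ ≤ 5 * dP * LP * (KL * ((B₀ * Amaj + 1) * (1 + 2 * b₁))) * (α₀ + α₁) ∧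
            msup (4 + 1) k |cf|⁻¹ (-3) (fun j (b : PBond (PV d 4 m K hd hL) 0) => j ≤ (blkV1 hN D b).1.1)
                (fun b : PBond (PV d 4 m K hd hL) 0 => laplace cf (fun z => A ⟨z, b.dir⟩) b.src) ≤
              5 * dP * LP * (KL * ((B₀ * Amaj + 1) * (1 + 2 * b₁))) * (α₀ + α₁) ∧
            (∀ b : PBond (PV d 4 m K hd hL) 0,
              |WithLp.ofLp A b| ≤ 5 * dP * LP * (KL * ((B₀ * Amaj + 1) * (1 + 2 * b₁))) * (α₀ + α₁) *
                (((geomT D).len (blkV1 hN D b) * |cf|⁻¹) ^ 1)⁻¹) ∧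
            (∀ (ν : Fin (d + 1)) (b : PBond (PV d 4 m K hd hL) 0),
              |Dop ν (WithLp.ofLp A) b| ≤ 5 * dP * LP * (KL * ((B₀ * Amaj + 1) * (1 + 2 * b₁))) * (α₀ + α₁) *
                (((geomT D).len (blkV1 hN D b) * |cf|⁻¹) ^ 2)⁻¹) ∧
            (∀ b : PBond (PV d 4 m K hd hL) 0,
              |laplace cf (fun z => A ⟨z, b.dir⟩) b.src| ≤ 5 * dP * LP * (KL * ((B₀ * Amaj + 1) * (1 + 2 * b₁))) * (α₀ + α₁) *
                (((geomT D).len (blkV1 hN D b) * |cf|⁻¹) ^ 3)⁻¹) := by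
  obtain ⟨σ, hσ, h⟩ := prop3_multiLevelTorus_V1_P26_line3 d 4 hd hL hb₀ hb₁
  refine ⟨σ, hσ, fun α hα0 hα1 => ?_⟩
  obtain ⟨B₀, KL, M₃, N₁, hB₀, hKL, hM₃, hN₁, h1⟩ := h α hα0 hα1
  refine ⟨B₀, KL, M₃, N₁, hB₀, hKL, hM₃, hN₁, fun N₀ hN₀ CD cD hCD hcD => ?_⟩
  obtain ⟨Amaj, M₁, hA, hM₁, h2⟩ := h1 N₀ hN₀ hCD hcD
  refine ⟨Amaj, M₁, hA, hM₁, ?_⟩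
  intro m K Mh k R P' hN D hk hk2 a hMha hM8 hR2 hP12 hM1t hM3t hN0t hN1t hbud cf hcf w hw hwb hline3
  exact h2 m K hN D hk hk2 hMha hM8 hR2 (fun μ => le_trans (by norm_num) (hP12 μ)) le_rfl (placed_all_cubes (D := D) rfl hP12)
    hM1t hM3t hN0t hN1t hbud hcf hw hwb hline3


/-! ## §5  (v1.2) EVERY ODD `L ≥ 5`, NO PLACEMENT HYPOTHESIS (p38's level padding) — slot 1 fed by `prop26_2136_kLevel_final_pad_le_V1` -/

open Classical in
/-- **[B8] PROPOSITION 3 AT `U₀ = 1` ON THE `k`-LEVEL V1 TORUS FOR EVERY ODD `L ≥ 5`, `k ≥ 1`, `P′ ≥ 5L` — NO PLACEMENT HYPOTHESIS, THE RATE A PARAMETER**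
(v1.2).  Slot 1 of `B8Prop3MultiLevelTorusLap.prop3_multiLevelTorus_V1_pref_vecLap` FED BY p38 g29's
`B6Prop26KLevelAssemblyPadV1.prop26_2136_kLevel_final_pad_le_V1` (p362298: r03's rate-parametrised assembly `prop26_2136_kLevel_final_le` run on the
PADDED family `padT D` of `B6PadLevelV1` — one more, empty, level, so r03's `placed_of_lt` places every cube; the padded family has literally the same `G`
(`SameOm.GE_eq`), blocks, distance (2.46) and prefactor; the padding data `P′ = L·(P′/L)`, `P′/L ≥ 5`, `k + 1 ≤ m + K` are DERIVED from `hN`, `M_h = Lᵃ` and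
`P′ ≥ 5L`; [B6] p. 224 *"we admit the case when some domains Ω_j are equal to T_η"* as quoted there).  Hence, compared with `prop3_multiLevelTorus_V1_P26_line3_le`:
the binders `Placed` and `2 ≤ k` are GONE (`1 ≤ k`), `5 ≤ P′` becomes `5L ≤ P′`, and the line-3 majorant (iv) is asked for the members of the cubes of
`padT D` (whoever proves (iv) for every admissible torus family proves it for `padT D` — p38's HONEST SCOPE (1)); everything else — r03's `σ₀`, the budget
`(α, N₀)` with its threshold, `A, M₁`, this lineage's `B₀, K_L, M₃, N₁` at the rate `(1 − α)σ`, slot 2, the B8-side hypotheses and THE SEVEN CONCLUSIONS of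
Proposition 3 at `U₀ = 1` with `B₀′ = K_L(B₀A + 1)(1 + 2b₁)` — is VERBATIM.  Proof = plumbing (`4 ≤ 5L ≤ P′`).  p. 87: *"then U₁ satisfies (1.36)–(1.39) with
B₁ = 5dLB₀, B₂(β₀) = 5dLB₀(β₀), where B₀, B₀(β₀) … depend on d and L only"*. [cite: Balaban1985RegularSpaces, Prop. 3 p.87, (1.59)–(1.62) pp.86–87, (1.55)–(1.58) p.86, (1.42) p.84; Balaban1984PropagatorsII, Prop. 2.6 (2.136) p.247, (2.133)–(2.135) p.247, (2.92) p.239, (2.1)–(2.4) p.224, (2.36) p.229; Balaban1985BackgroundPropagators, Theorem 3.3 p.399, (3.47) p.398] -/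
theorem prop3_multiLevelTorus_V1_P26_pad_line3_le (d ℓ : ℕ) (hd : 1 ≤ d + 1) (hL : Odd (ℓ + 1) ∧ 1 < ℓ + 1) {b₀ b₁ : ℝ} (hb₀ : 0 < b₀) (hb₁ : b₀ ≤ b₁) :
    ∃ σ₀ : ℝ, 0 < σ₀ ∧ ∀ (σ : ℝ), 0 < σ → σ ≤ σ₀ → ∀ (α : ℝ), 0 ≤ α → α < 1 →
    ∃ B₀ KL M₃ : ℝ, ∃ N₁ : ℕ, 1 ≤ B₀ ∧ 1 ≤ KL ∧ 0 < M₃ ∧ 0 < N₁ ∧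
    ∀ (N₀ : ℕ), 0 < N₀ → ∀ {CD cD : ℝ}, 0 ≤ CD → 0 < cD →
    ∃ Amaj M₁ : ℝ, 0 ≤ Amaj ∧ 0 < M₁ ∧
    ∀ (m K : ℕ) {Mh k R : ℕ} {P' : Fin (d + 1) → ℕ}
      (hN : ∀ μ, N0 ℓ Mh k P' μ = (PV d ℓ m K hd hL).sitesPerDir 0) (D : TDomains d ℓ Mh k P' R) (hk : k ≤ m + K) (_ : 1 ≤ k)
      {a : ℕ} (hMha : Mh = (ℓ + 1) ^ a) (hM8 : 8 ≤ Mh) (_ : 2 * (ℓ + 1) ^ 2 ≤ R) (hP : ∀ μ, 5 * (ℓ + 1) ≤ P' μ) (_ : 4 ≤ ℓ)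
      (_ : M₁ ≤ ((ℓ : ℝ) + 1) * Mh) (_ : M₃ ≤ ((ℓ : ℝ) + 1) * Mh) (_ : N₀ + 1 ≤ R * ((ℓ + 1) * Mh)) (_ : N₁ + 1 ≤ R * ((ℓ + 1) * Mh))
      (_ : Real.exp (-(α * σ)) * ((ℓ : ℝ) + 1) ^ ((2 * (d + 1 : ℕ) : ℝ) / N₀) < 1)
      {cf : ℝ} (hcf : cf ≠ 0) {w : BondIdx (domT hN D hk) → ℝ} (hw : ∀ i, 0 < w i) (_ : GlobalBand b₀ b₁ cf w)
      -- line 3 (p38/p22) for the members of the cubes of the PADDED family `padT D` (p38's `B6PadLevelV1`: one more, empty, level; every cube placed —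
      -- `placed_pad`; padding data `P′ = L·(P′/L)`, `P′/L ≥ 5`, `k + 1 ≤ m + K` derived by `hLP_of_V1`/`hP5_of_V1`/`hk'_of_V1`), AT ANY RATE `2σ`, `0 < σ ≤ σ₀`
      (_ : ∀ c : ↥(cubes (padT D (hLP_of_V1 hN hMha hP)).toDomains),
        HasMajorant (g := geomTB (padT D (hLP_of_V1 hN hMha hP))) (blkV1 (hN_pad hN (hLP_of_V1 hN hMha hP)) (padT D (hLP_of_V1 hN hMha hP)))
        (mulOp (zB (hN_pad hN (hLP_of_V1 hN hMha hP)) (padT D (hLP_of_V1 hN hMha hP)) (one_le_of_eight_le hM8)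
            (four_le_of_five_le (hP5_of_V1 hP)) c) *
          (onFun (dE (P := PV d ℓ m K hd hL) cf ∘ₗ
              (LinearMap.id - RE (domT (hN_pad hN (hLP_of_V1 hN hMha hP)) (padT D (hLP_of_V1 hN hMha hP)) (hk'_of_V1 hN hMha hP)) cf) ∘ₗ dsE cf) -
            Pl (hN_pad hN (hLP_of_V1 hN hMha hP)) (hk'_of_V1 hN hMha hP) (one_le_of_eight_le hM8) (four_le_of_five_le (hP5_of_V1 hP)) hMha c
              (band_le (d := d) (ℓ := ℓ) hb₀ hb₁) (placed_pad D (hLP_of_V1 hN hMha hP) (hP5_of_V1 hP) c)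
              (w ∘ (sameOm_domT_pad hN D hk (hLP_of_V1 hN hMha hP) (hk'_of_V1 hN hMha hP)).idxB) cf) *
          mulOp (hB (hN_pad hN (hLP_of_V1 hN hMha hP)) (padT D (hLP_of_V1 hN hMha hP)) c))
        (fun y y'' => CD * cf ^ 2 * Real.exp (-(cD * (geomTB (padT D (hLP_of_V1 hN hMha hP))).M)) /
          (geomTB (padT D (hLP_of_V1 hN hMha hP))).len y ^ 2 * Real.exp (-((2 * σ) * (geomTB (padT D (hLP_of_V1 hN hMha hP))).dist y y''))))
      -- slot 2: the (2.136)₂-shape majorants of `∇G(1)` for the abstract first-order `Dop ν` (no k-level producer yet)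
      (Dop : Fin (d + 1) → Module.End ℝ (PBond (PV d ℓ m K hd hL) 0 → ℝ)),
      (∀ ν, HasMajorant (g := geomT D) (blkV1 hN D) (Dop ν ∘ₗ onFun (GE (domT hN D hk) hcf hw))
        (fun y y' => Amaj * ((geomT D).len y * |cf|⁻¹) * Real.exp (-(delta3 α (2 * σ) * (geomT D).dist y y')))) →
      ∀ (A J : BondSpace (PV d ℓ m K hd hL)) (B : BondIdxSpace (domT hN D hk)),
        dcsE cf (dcE cf A) = J → RE (domT hN D hk) cf (dsE cf A) = 0 → QE (domT hN D hk) A = B →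
        ∀ (nJ nB : ℝ), 0 ≤ nJ → 0 ≤ nB →
          (∀ b, |J b| ≤ nJ * (((geomT D).len (blkV1 hN D b) * |cf|⁻¹) ^ 3)⁻¹) →
          (∀ i, |B i| ≤ nB * (((ℓ : ℝ) + 1) ^ (i.1.1 : ℕ) * |cf|⁻¹)⁻¹) →
        ∀ (dP LP C₂ α₀ α₁ α₂ : ℝ), 0 ≤ dP → 1 ≤ dP * LP → 0 ≤ α₀ → 0 ≤ α₁ → 0 ≤ α₂ →
          nJ ≤ 2 * α₀ + 36 * dP * α₂ *
              msup (ℓ + 1) k |cf|⁻¹ (-2) (fun j (p : Fin (d + 1) × PBond (PV d ℓ m K hd hL) 0) => j ≤ (blkV1 hN D p.2).1.1)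
                (fun p : Fin (d + 1) × PBond (PV d ℓ m K hd hL) 0 => Dop p.1 (WithLp.ofLp A) p.2) +
            50 * dP * α₂ ^ 3 + 10 * dP * α₀ * α₂ →
          nB ≤ 2 * dP * LP * α₁ + C₂ * α₂ ^ 2 →
          36 * dP * (KL * ((B₀ * Amaj + 1) * (1 + 2 * b₁))) * α₂ ≤ 1 / 2 → 50 * dP * α₂ ≤ 1 →
          2 * α₂ ^ 2 + 20 * dP * α₀ * α₂ + 2 * C₂ * α₂ ^ 2 ≤ α₀ + α₁ →
          msup (ℓ + 1) k |cf|⁻¹ (-1) (fun j (b : PBond (PV d ℓ m K hd hL) 0) => j ≤ (blkV1 hN D b).1.1) (WithLp.ofLp A) ≤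
              5 * dP * LP * (KL * ((B₀ * Amaj + 1) * (1 + 2 * b₁))) * (α₀ + α₁) ∧
            msup (ℓ + 1) k |cf|⁻¹ (-2) (fun j (p : Fin (d + 1) × PBond (PV d ℓ m K hd hL) 0) => j ≤ (blkV1 hN D p.2).1.1)
                (fun p : Fin (d + 1) × PBond (PV d ℓ m K hd hL) 0 => Dop p.1 (WithLp.ofLp A) p.2) ≤
              5 * dP * LP * (KL * ((B₀ * Amaj + 1) * (1 + 2 * b₁))) * (α₀ + α₁) ∧
            nJ ≤ 5 * dP * LP * (KL * ((B₀ * Amaj + 1) * (1 + 2 * b₁))) * (α₀ + α₁) ∧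
            msup (ℓ + 1) k |cf|⁻¹ (-3) (fun j (b : PBond (PV d ℓ m K hd hL) 0) => j ≤ (blkV1 hN D b).1.1)
                (fun b : PBond (PV d ℓ m K hd hL) 0 => laplace cf (fun z => A ⟨z, b.dir⟩) b.src) ≤
              5 * dP * LP * (KL * ((B₀ * Amaj + 1) * (1 + 2 * b₁))) * (α₀ + α₁) ∧
            (∀ b : PBond (PV d ℓ m K hd hL) 0,
              |WithLp.ofLp A b| ≤ 5 * dP * LP * (KL * ((B₀ * Amaj + 1) * (1 + 2 * b₁))) * (α₀ + α₁) *
                (((geomT D).len (blkV1 hN D b) * |cf|⁻¹) ^ 1)⁻¹) ∧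
            (∀ (ν : Fin (d + 1)) (b : PBond (PV d ℓ m K hd hL) 0),
              |Dop ν (WithLp.ofLp A) b| ≤ 5 * dP * LP * (KL * ((B₀ * Amaj + 1) * (1 + 2 * b₁))) * (α₀ + α₁) *
                (((geomT D).len (blkV1 hN D b) * |cf|⁻¹) ^ 2)⁻¹) ∧
            (∀ b : PBond (PV d ℓ m K hd hL) 0,
              |laplace cf (fun z => A ⟨z, b.dir⟩) b.src| ≤ 5 * dP * LP * (KL * ((B₀ * Amaj + 1) * (1 + 2 * b₁))) * (α₀ + α₁) *
                (((geomT D).len (blkV1 hN D b) * |cf|⁻¹) ^ 3)⁻¹) := by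
  -- p38's/r03's admissible range of rates `(0, σ₀]` for the band `[b₀, b₁]`
  obtain ⟨σ₀, hσ₀, h26⟩ := prop26_2136_kLevel_final_pad_le_V1 d ℓ hd hL hb₀ hb₁
  refine ⟨σ₀, hσ₀, fun σ hσ hσle α hα0 hα1 => ?_⟩
  -- the decay rate of the delivered majorant and this lineage's constants at that rate
  have hσ' : 0 < delta3 α (2 * σ) := delta3_pos hα1 (by positivity)
  obtain ⟨B₀, KL, M₃, N₁, hB₀, hKL, hM₃, hN₁, hS⟩ := prop3_multiLevelTorus_V1_pref_vecLap d ℓ hd hL hσ'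
  refine ⟨B₀, KL, M₃, N₁, hB₀, hKL, hM₃, hN₁, fun N₀ hN₀ CD cD hCD hcD => ?_⟩
  -- the assembly's constants `A, M₁`
  obtain ⟨Amaj, M₁, hA, hM₁, hG26⟩ := h26 σ hσ hσle α hα0 hα1.le N₀ hN₀ hCD hcD
  refine ⟨Amaj, M₁, hA, hM₁, ?_⟩
  intro m K Mh k R P' hN D hk hk1 a hMha hM8 hR2 hP hℓ4 hM1t hM3t hN0t hN1t hbud cf hcf w hw hwb hline3
    Dop hD A J B h55 h42 h56 nJ nB hnJ hnB hJ hB dP LP C₂ α₀ α₁ α₂ hdP hdL hα₀ hα₁ hα₂ h55s h56s hside h50 h61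
  -- slot 1 = p38's conclusion for the genuine `G` of `D` at the rate `2σ`, literally
  have hG := hG26 m K hN D hk hk1 hMha hM8 hR2 hP hℓ4 hM1t hN0t hbud hcf hw hwb hline3
  -- the assembly's thresholds imply this lineage's
  have hMh1 : 1 ≤ Mh := le_trans (by norm_num) hM8
  have hR2' : 2 * (ℓ + 1) ≤ R := by
    have h1 : ℓ + 1 ≤ (ℓ + 1) ^ 2 := by nlinarith
    exact le_trans (Nat.mul_le_mul_left 2 h1) hR2
  have hP4 : ∀ μ, 4 ≤ P' μ := fun μ => le_trans (by omega) (hP μ)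
  exact hS k Mh R hMh1 hN1t hR2' hM3t P' hP4 D m K hN hk cf hcf w hw b₀ b₁ hb₀.le (hb₀.le.trans hb₁) hwb Amaj hA Dop hG hD
    A J B h55 h42 h56 nJ nB hnJ hnB hJ hB dP LP C₂ α₀ α₁ α₂ hdP hdL hα₀ hα₁ hα₂ h55s h56s hside h50 h61

/-! ## §6  (v1.3) ONE SIZE THRESHOLD — the Lemma-2.1 budget ABSORBED: slot 1 fed by p38's `prop26_2136_kLevel_final_pad_M_V1` (r03's v1.5 `_final_M`, padded) -/

open Classical in
/-- **[B8] PROPOSITION 3 AT `U₀ = 1` ON THE `k`-LEVEL V1 TORUS FOR EVERY ODD `L ≥ 5`, `k ≥ 1`, `P′ ≥ 5L` — NO PLACEMENT HYPOTHESIS, NO LEMMA-2.1 BUDGET,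
ONE SIZE THRESHOLD, THE RATE A PARAMETER** (v1.3).  Slot 1 of `B8Prop3MultiLevelTorusLap.prop3_multiLevelTorus_V1_pref_vecLap` FED BY p38 g29's
`B6Prop26KLevelAssemblyPadV1.prop26_2136_kLevel_final_pad_M_V1` (v1.1, p364076: r03's v1.5 `B6Prop26KLevelAssemblyV1.prop26_2136_kLevel_final_M` — for
`α > 0` the Lemma-2.1 exponent `N₀ := ⌈2(d+1)·log L/(ασ)⌉ + 1` is CHOSEN INSIDE (`e^{−ασ}L^{2(d+1)/N₀} < 1`) and `N₀ + 1 ≤ R·L·M_h` follows from ONE size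
threshold `M₂ ≤ L·M_h` — run on the padded family `padT D` of `B6PadLevelV1` and stated on the original data, `P′ ≥ 5L`).  Hence, compared with
`prop3_multiLevelTorus_V1_P26_pad_line3_le` (§5): the budget binders `N₀`, `0 < N₀`, `N₀ + 1 ≤ R·L·M_h`, `e^{−ασ}L^{2(d+1)/N₀} < 1` are GONE, `0 ≤ α` becomes
`0 < α` (still `α < 1`, the rate of the delivered majorant being `delta3 α (2σ) = (1 − α)·2σ > 0`), and the four size thresholds `M₁, M₃ ≤ L·M_h`,
`N₀ + 1, N₁ + 1 ≤ R·L·M_h` collapse to ONE, `M₄ ≤ L·M_h` (`M₄ := max M₂ (max M₃ (N₁ + 1))`; `N₁ + 1 ≤ L·M_h ≤ R·L·M_h`); the constants `B₀, K_L` of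
this lineage are chosen before `C_D, c_D`, the assembly's `A` and the threshold `M₄` after; the line-3 majorant (iv) for the members of the cubes of
`padT D` at the rate `2σ`, slot 2, the B8-side hypotheses and THE SEVEN CONCLUSIONS of Proposition 3 at `U₀ = 1` with `B₀′ = K_L(B₀A + 1)(1 + 2b₁)` are
VERBATIM.  So PROPOSITION 3 AT `U₀ = 1` (vector side) on the `k`-level V1 torus now rests on: the line-3 majorant (iv) (ONE displayed analytic per-cube
input; r03 g22's `hD3_cube`, in progress), the (2.136)₂ majorants of `∇G(1)` (slot 2; no `k`-level producer) and the B8-side hypotheses ONLY.  Proof =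
plumbing.  p. 87: *"then U₁ satisfies (1.36)–(1.39) with B₁ = 5dLB₀, B₂(β₀) = 5dLB₀(β₀), where B₀, B₀(β₀) … depend on d and L only"*; [B6] p. 247 (2.136)
through r03's quotation. [cite: Balaban1985RegularSpaces, Prop. 3 p.87, (1.59)–(1.62) pp.86–87, (1.55)–(1.58) p.86, (1.42) p.84; Balaban1984PropagatorsII, Prop. 2.6 (2.136) p.247, (2.133)–(2.135) p.247, (2.92) p.239, (2.1)–(2.4) p.224, (2.36) p.229, Lemma 2.1 p.234; Balaban1985BackgroundPropagators, Theorem 3.3 p.399, (3.47) p.398] -/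
theorem prop3_multiLevelTorus_V1_P26_pad_M (d ℓ : ℕ) (hd : 1 ≤ d + 1) (hL : Odd (ℓ + 1) ∧ 1 < ℓ + 1) {b₀ b₁ : ℝ} (hb₀ : 0 < b₀) (hb₁ : b₀ ≤ b₁) :
    ∃ σ₀ : ℝ, 0 < σ₀ ∧ ∀ (σ : ℝ), 0 < σ → σ ≤ σ₀ → ∀ (α : ℝ), 0 < α → α < 1 →
    ∃ B₀ KL : ℝ, 1 ≤ B₀ ∧ 1 ≤ KL ∧
    ∀ {CD cD : ℝ}, 0 ≤ CD → 0 < cD →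
    ∃ Amaj M₄ : ℝ, 0 ≤ Amaj ∧ 0 < M₄ ∧
    ∀ (m K : ℕ) {Mh k R : ℕ} {P' : Fin (d + 1) → ℕ}
      (hN : ∀ μ, N0 ℓ Mh k P' μ = (PV d ℓ m K hd hL).sitesPerDir 0) (D : TDomains d ℓ Mh k P' R) (hk : k ≤ m + K) (_ : 1 ≤ k)
      {a : ℕ} (hMha : Mh = (ℓ + 1) ^ a) (hM8 : 8 ≤ Mh) (_ : 2 * (ℓ + 1) ^ 2 ≤ R) (hP : ∀ μ, 5 * (ℓ + 1) ≤ P' μ) (_ : 4 ≤ ℓ)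
      -- ONE size threshold (r03's v1.5 / p38's v1.1: the Lemma-2.1 exponent `N₀` chosen inside; this lineage's `M₃`, `N₁ + 1` folded in as well)
      (_ : M₄ ≤ ((ℓ : ℝ) + 1) * Mh)
      {cf : ℝ} (hcf : cf ≠ 0) {w : BondIdx (domT hN D hk) → ℝ} (hw : ∀ i, 0 < w i) (_ : GlobalBand b₀ b₁ cf w)
      -- line 3 (iv) (r03 g22 / p38 / p22, in progress) for the members of the cubes of the PADDED family `padT D`, AT ANY RATE `2σ`, `0 < σ ≤ σ₀` — VERBATIM
      -- the binder of `B6Prop26KLevelAssemblyPadV1.prop26_2136_kLevel_final_pad_M_V1`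
      (_ : ∀ c : ↥(cubes (padT D (hLP_of_V1 hN hMha hP)).toDomains),
        HasMajorant (g := geomTB (padT D (hLP_of_V1 hN hMha hP))) (blkV1 (hN_pad hN (hLP_of_V1 hN hMha hP)) (padT D (hLP_of_V1 hN hMha hP)))
        (mulOp (zB (hN_pad hN (hLP_of_V1 hN hMha hP)) (padT D (hLP_of_V1 hN hMha hP)) (one_le_of_eight_le hM8)
            (four_le_of_five_le (hP5_of_V1 hP)) c) *
          (onFun (dE (P := PV d ℓ m K hd hL) cf ∘ₗ
              (LinearMap.id - RE (domT (hN_pad hN (hLP_of_V1 hN hMha hP)) (padT D (hLP_of_V1 hN hMha hP)) (hk'_of_V1 hN hMha hP)) cf) ∘ₗ dsE cf) -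
            Pl (hN_pad hN (hLP_of_V1 hN hMha hP)) (hk'_of_V1 hN hMha hP) (one_le_of_eight_le hM8) (four_le_of_five_le (hP5_of_V1 hP)) hMha c
              (band_le (d := d) (ℓ := ℓ) hb₀ hb₁) (placed_pad D (hLP_of_V1 hN hMha hP) (hP5_of_V1 hP) c)
              (w ∘ (sameOm_domT_pad hN D hk (hLP_of_V1 hN hMha hP) (hk'_of_V1 hN hMha hP)).idxB) cf) *
          mulOp (hB (hN_pad hN (hLP_of_V1 hN hMha hP)) (padT D (hLP_of_V1 hN hMha hP)) c))
        (fun y y'' => CD * cf ^ 2 * Real.exp (-(cD * (geomTB (padT D (hLP_of_V1 hN hMha hP))).M)) /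
          (geomTB (padT D (hLP_of_V1 hN hMha hP))).len y ^ 2 * Real.exp (-((2 * σ) * (geomTB (padT D (hLP_of_V1 hN hMha hP))).dist y y''))))
      -- slot 2: the (2.136)₂-shape majorants of `∇G(1)` for the abstract first-order `Dop ν` (no k-level producer yet)
      (Dop : Fin (d + 1) → Module.End ℝ (PBond (PV d ℓ m K hd hL) 0 → ℝ)),
      (∀ ν, HasMajorant (g := geomT D) (blkV1 hN D) (Dop ν ∘ₗ onFun (GE (domT hN D hk) hcf hw))
        (fun y y' => Amaj * ((geomT D).len y * |cf|⁻¹) * Real.exp (-(delta3 α (2 * σ) * (geomT D).dist y y')))) →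
      ∀ (A J : BondSpace (PV d ℓ m K hd hL)) (B : BondIdxSpace (domT hN D hk)),
        dcsE cf (dcE cf A) = J → RE (domT hN D hk) cf (dsE cf A) = 0 → QE (domT hN D hk) A = B →
        ∀ (nJ nB : ℝ), 0 ≤ nJ → 0 ≤ nB →
          (∀ b, |J b| ≤ nJ * (((geomT D).len (blkV1 hN D b) * |cf|⁻¹) ^ 3)⁻¹) →
          (∀ i, |B i| ≤ nB * (((ℓ : ℝ) + 1) ^ (i.1.1 : ℕ) * |cf|⁻¹)⁻¹) →
        ∀ (dP LP C₂ α₀ α₁ α₂ : ℝ), 0 ≤ dP → 1 ≤ dP * LP → 0 ≤ α₀ → 0 ≤ α₁ → 0 ≤ α₂ →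
          nJ ≤ 2 * α₀ + 36 * dP * α₂ *
              msup (ℓ + 1) k |cf|⁻¹ (-2) (fun j (p : Fin (d + 1) × PBond (PV d ℓ m K hd hL) 0) => j ≤ (blkV1 hN D p.2).1.1)
                (fun p : Fin (d + 1) × PBond (PV d ℓ m K hd hL) 0 => Dop p.1 (WithLp.ofLp A) p.2) +
            50 * dP * α₂ ^ 3 + 10 * dP * α₀ * α₂ →
          nB ≤ 2 * dP * LP * α₁ + C₂ * α₂ ^ 2 →
          36 * dP * (KL * ((B₀ * Amaj + 1) * (1 + 2 * b₁))) * α₂ ≤ 1 / 2 → 50 * dP * α₂ ≤ 1 →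
          2 * α₂ ^ 2 + 20 * dP * α₀ * α₂ + 2 * C₂ * α₂ ^ 2 ≤ α₀ + α₁ →
          msup (ℓ + 1) k |cf|⁻¹ (-1) (fun j (b : PBond (PV d ℓ m K hd hL) 0) => j ≤ (blkV1 hN D b).1.1) (WithLp.ofLp A) ≤
              5 * dP * LP * (KL * ((B₀ * Amaj + 1) * (1 + 2 * b₁))) * (α₀ + α₁) ∧
            msup (ℓ + 1) k |cf|⁻¹ (-2) (fun j (p : Fin (d + 1) × PBond (PV d ℓ m K hd hL) 0) => j ≤ (blkV1 hN D p.2).1.1)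
                (fun p : Fin (d + 1) × PBond (PV d ℓ m K hd hL) 0 => Dop p.1 (WithLp.ofLp A) p.2) ≤
              5 * dP * LP * (KL * ((B₀ * Amaj + 1) * (1 + 2 * b₁))) * (α₀ + α₁) ∧
            nJ ≤ 5 * dP * LP * (KL * ((B₀ * Amaj + 1) * (1 + 2 * b₁))) * (α₀ + α₁) ∧
            msup (ℓ + 1) k |cf|⁻¹ (-3) (fun j (b : PBond (PV d ℓ m K hd hL) 0) => j ≤ (blkV1 hN D b).1.1)
                (fun b : PBond (PV d ℓ m K hd hL) 0 => laplace cf (fun z => A ⟨z, b.dir⟩) b.src) ≤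
              5 * dP * LP * (KL * ((B₀ * Amaj + 1) * (1 + 2 * b₁))) * (α₀ + α₁) ∧
            (∀ b : PBond (PV d ℓ m K hd hL) 0,
              |WithLp.ofLp A b| ≤ 5 * dP * LP * (KL * ((B₀ * Amaj + 1) * (1 + 2 * b₁))) * (α₀ + α₁) *
                (((geomT D).len (blkV1 hN D b) * |cf|⁻¹) ^ 1)⁻¹) ∧
            (∀ (ν : Fin (d + 1)) (b : PBond (PV d ℓ m K hd hL) 0),
              |Dop ν (WithLp.ofLp A) b| ≤ 5 * dP * LP * (KL * ((B₀ * Amaj + 1) * (1 + 2 * b₁))) * (α₀ + α₁) *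
                (((geomT D).len (blkV1 hN D b) * |cf|⁻¹) ^ 2)⁻¹) ∧
            (∀ b : PBond (PV d ℓ m K hd hL) 0,
              |laplace cf (fun z => A ⟨z, b.dir⟩) b.src| ≤ 5 * dP * LP * (KL * ((B₀ * Amaj + 1) * (1 + 2 * b₁))) * (α₀ + α₁) *
                (((geomT D).len (blkV1 hN D b) * |cf|⁻¹) ^ 3)⁻¹) := by
  -- p38's/r03's admissible range of rates `(0, σ₀]` for the band `[b₀, b₁]` (v1.1 of `B6Prop26KLevelAssemblyPadV1`: the budget absorbed)
  obtain ⟨σ₀, hσ₀, h26⟩ := prop26_2136_kLevel_final_pad_M_V1 d ℓ hd hL hb₀ hb₁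
  refine ⟨σ₀, hσ₀, fun σ hσ hσle α hα0 hα1 => ?_⟩
  -- the decay rate of the delivered majorant and this lineage's constants at that rate
  have hσ' : 0 < delta3 α (2 * σ) := delta3_pos hα1 (by positivity)
  obtain ⟨B₀, KL, M₃, N₁, hB₀, hKL, hM₃, hN₁, hS⟩ := prop3_multiLevelTorus_V1_pref_vecLap d ℓ hd hL hσ'
  refine ⟨B₀, KL, hB₀, hKL, fun {CD cD} hCD hcD => ?_⟩
  -- the assembly's constants `A, M₂`; ONE threshold `M₄ := max M₂ (max M₃ (N₁ + 1))`
  obtain ⟨Amaj, M₂, hA, hM₂, hG26⟩ := h26 σ hσ hσle α hα0 hα1.le hCD hcD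
  refine ⟨Amaj, max M₂ (max M₃ ((N₁ : ℝ) + 1)), hA, lt_max_of_lt_left hM₂, ?_⟩
  intro m K Mh k R P' hN D hk hk1 a hMha hM8 hR2 hP hℓ4 hM4t cf hcf w hw hwb hline3
    Dop hD A J B h55 h42 h56 nJ nB hnJ hnB hJ hB dP LP C₂ α₀ α₁ α₂ hdP hdL hα₀ hα₁ hα₂ h55s h56s hside h50 h61
  -- the single threshold implies the three it replaces
  have hM2t : M₂ ≤ ((ℓ : ℝ) + 1) * Mh := le_trans (le_max_left _ _) hM4t
  have hM3t : M₃ ≤ ((ℓ : ℝ) + 1) * Mh := le_trans ((le_max_left _ _).trans (le_max_right _ _)) hM4t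
  have hN1r : (N₁ : ℝ) + 1 ≤ ((ℓ : ℝ) + 1) * Mh := le_trans ((le_max_right _ _).trans (le_max_right _ _)) hM4t
  have hN1t : N₁ + 1 ≤ R * ((ℓ + 1) * Mh) := by
    have h1 : N₁ + 1 ≤ (ℓ + 1) * Mh := by exact_mod_cast hN1r
    have hR1 : 1 ≤ R := le_trans (Nat.one_le_iff_ne_zero.mpr (by positivity)) hR2
    calc N₁ + 1 ≤ (ℓ + 1) * Mh := h1
      _ = 1 * ((ℓ + 1) * Mh) := (one_mul _).symm
      _ ≤ R * ((ℓ + 1) * Mh) := Nat.mul_le_mul_right _ hR1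
  -- slot 1 = p38's conclusion for the genuine `G` of `D` at the rate `2σ`, literally
  have hG := hG26 m K hN D hk hk1 hMha hM8 hR2 hP hℓ4 hM2t hcf hw hwb hline3
  -- the assembly's thresholds imply this lineage's
  have hMh1 : 1 ≤ Mh := le_trans (by norm_num) hM8
  have hR2' : 2 * (ℓ + 1) ≤ R := by
    have h1 : ℓ + 1 ≤ (ℓ + 1) ^ 2 := by nlinarith
    exact le_trans (Nat.mul_le_mul_left 2 h1) hR2
  have hP4 : ∀ μ, 4 ≤ P' μ := fun μ => le_trans (by omega) (hP μ)
  exact hS k Mh R hMh1 hN1t hR2' hM3t P' hP4 D m K hN hk cf hcf w hw b₀ b₁ hb₀.le (hb₀.le.trans hb₁) hwb Amaj hA Dop hG hD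
    A J B h55 h42 h56 nJ nB hnJ hnB hJ hB dP LP C₂ α₀ α₁ α₂ hdP hdL hα₀ hα₁ hα₂ h55s h56s hside h50 h61


/-! ## §7  (v1.4) LINE 3 DISCHARGED — r03 g22's `B6Line3CubeV1.line3_cube` on the cubes of `padT D`: Proposition 3 at `U₀ = 1` modulo SLOT 2 + the B8-side hypotheses ONLY -/

open Classical in
/-- **[B8] PROPOSITION 3 AT `U₀ = 1` ON THE `k`-LEVEL V1 TORUS FOR EVERY ODD `L ≥ 5`, `k ≥ 1`, `P′ ≥ 5L` — NO PER-CUBE ANALYTIC HYPOTHESIS LEFT**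
(v1.4).  §6 (`prop3_multiLevelTorus_V1_P26_pad_M`) with its LAST displayed per-cube input, the line-3 majorant (iv) of [B6] (2.92) for the members of the cubes
of the padded family `padT D`, DISCHARGED by r03 g22's `B6Line3CubeV1.line3_cube` (p366020; built on p22's `B6Line3WindowV1.line3_window` and r03's
`B6Line3CutoffV1`/`B6Line3GapV1`/`B6Line3ProfileV1`): that theorem delivers, for the band `[b₀, b₁]`, a rate `ρ₃ > 0`, constants `C_D ≥ 0`, `c_D > 0` and a
threshold `M₃` such that line 3 holds for EVERY cube of EVERY `k`-level V1 torus family with `k ≥ 2`, `M_h = L^a ≥ 8`, `R ≥ 2L²`, `P′ ≥ 5`, `L ≥ 5`, every cube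
placed and `M₃ ≤ L·M_h`; it is applied to the `(k+1)`-level family `padT D` (p38's `B6PadLevelV1`: `hN_pad`, `hk'_of_V1`, `hP5_of_V1`, and `placed_pad` —
EVERY cube of a padded family is placed), so NO placement hypothesis and `k ≥ 1` suffice on the original data; the rate is weakened `ρ₃ → 2σ` for
`σ ≤ min σ₀ (ρ₃/2)` by `B6RandomWalk.hasMajorant_mono` (`e^{−ρ₃d} ≤ e^{−2σd}`, `d ≥ 0` by `B6Ineq2134KLevelTorus.dist_nonneg_TB`), and `C_D, c_D` are fed to
§6 where it quantified over them.  Compared with §6: the `∀ C_D c_D` level and the line-3 binder are GONE, the admissible rates shrink to `(0, min σ₀ (ρ₃/2)]`,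
the threshold becomes `max M₄ M₃ ≤ L·M_h` (still ONE); slot 2, the B8-side hypotheses and THE SEVEN CONCLUSIONS of Proposition 3 at `U₀ = 1` with
`B₀′ = K_L(B₀A + 1)(1 + 2b₁)` are VERBATIM.  So PROPOSITION 3 AT `U₀ = 1` (vector side) on the `k`-level V1 torus, every odd `L ≥ 5`, now rests on: the
(2.136)₂ majorants of `∇G(1)` (slot 2; p38 g30's `B6Prop26GradKLevelV1` in progress) and the B8-side hypotheses (1.55)/(1.42)/(1.56)/size lines ONLY.  Proof =
plumbing.  p. 87: *"then U₁ satisfies (1.36)–(1.39) with B₁ = 5dLB₀, B₂(β₀) = 5dLB₀(β₀), where B₀, B₀(β₀) … depend on d and L only"*; [B6] p. 239 (2.92) line 3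
and p. 247 (2.136) through r03's quotations. [cite: Balaban1985RegularSpaces, Prop. 3 p.87, (1.59)–(1.62) pp.86–87, (1.55)–(1.58) p.86, (1.42) p.84; Balaban1984PropagatorsII, Prop. 2.6 (2.136) p.247, (2.92) p.239, (2.133)–(2.135) p.247, (2.1)–(2.4) p.224, (2.36) p.229; Balaban1985BackgroundPropagators, Theorem 3.3 p.399, (3.47) p.398] -/
theorem prop3_multiLevelTorus_V1_P26_free (d ℓ : ℕ) (hd : 1 ≤ d + 1) (hL : Odd (ℓ + 1) ∧ 1 < ℓ + 1) {b₀ b₁ : ℝ} (hb₀ : 0 < b₀) (hb₁ : b₀ ≤ b₁) :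
    ∃ σ₀ : ℝ, 0 < σ₀ ∧ ∀ (σ : ℝ), 0 < σ → σ ≤ σ₀ → ∀ (α : ℝ), 0 < α → α < 1 →
    ∃ B₀ KL : ℝ, 1 ≤ B₀ ∧ 1 ≤ KL ∧
    ∃ Amaj M₄ : ℝ, 0 ≤ Amaj ∧ 0 < M₄ ∧
    ∀ (m K : ℕ) {Mh k R : ℕ} {P' : Fin (d + 1) → ℕ}
      (hN : ∀ μ, N0 ℓ Mh k P' μ = (PV d ℓ m K hd hL).sitesPerDir 0) (D : TDomains d ℓ Mh k P' R) (hk : k ≤ m + K) (_ : 1 ≤ k)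
      {a : ℕ} (hMha : Mh = (ℓ + 1) ^ a) (hM8 : 8 ≤ Mh) (_ : 2 * (ℓ + 1) ^ 2 ≤ R) (hP : ∀ μ, 5 * (ℓ + 1) ≤ P' μ) (_ : 4 ≤ ℓ)
      -- ONE size threshold (v1.3's `M₄` with r03 g22's line-3 threshold `M₃` folded in)
      (_ : M₄ ≤ ((ℓ : ℝ) + 1) * Mh)
      {cf : ℝ} (hcf : cf ≠ 0) {w : BondIdx (domT hN D hk) → ℝ} (hw : ∀ i, 0 < w i) (_ : GlobalBand b₀ b₁ cf w)
      -- line 3 (iv): NO LONGER A HYPOTHESIS (v1.4) — discharged inside by r03 g22's `B6Line3CubeV1.line3_cube` on the cubes of the padded family `padT D`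
      -- slot 2: the (2.136)₂-shape majorants of `∇G(1)` for the abstract first-order `Dop ν` (no k-level producer yet)
      (Dop : Fin (d + 1) → Module.End ℝ (PBond (PV d ℓ m K hd hL) 0 → ℝ)),
      (∀ ν, HasMajorant (g := geomT D) (blkV1 hN D) (Dop ν ∘ₗ onFun (GE (domT hN D hk) hcf hw))
        (fun y y' => Amaj * ((geomT D).len y * |cf|⁻¹) * Real.exp (-(delta3 α (2 * σ) * (geomT D).dist y y')))) →
      ∀ (A J : BondSpace (PV d ℓ m K hd hL)) (B : BondIdxSpace (domT hN D hk)),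
        dcsE cf (dcE cf A) = J → RE (domT hN D hk) cf (dsE cf A) = 0 → QE (domT hN D hk) A = B →
        ∀ (nJ nB : ℝ), 0 ≤ nJ → 0 ≤ nB →
          (∀ b, |J b| ≤ nJ * (((geomT D).len (blkV1 hN D b) * |cf|⁻¹) ^ 3)⁻¹) →
          (∀ i, |B i| ≤ nB * (((ℓ : ℝ) + 1) ^ (i.1.1 : ℕ) * |cf|⁻¹)⁻¹) →
        ∀ (dP LP C₂ α₀ α₁ α₂ : ℝ), 0 ≤ dP → 1 ≤ dP * LP → 0 ≤ α₀ → 0 ≤ α₁ → 0 ≤ α₂ →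
          nJ ≤ 2 * α₀ + 36 * dP * α₂ *
              msup (ℓ + 1) k |cf|⁻¹ (-2) (fun j (p : Fin (d + 1) × PBond (PV d ℓ m K hd hL) 0) => j ≤ (blkV1 hN D p.2).1.1)
                (fun p : Fin (d + 1) × PBond (PV d ℓ m K hd hL) 0 => Dop p.1 (WithLp.ofLp A) p.2) +
            50 * dP * α₂ ^ 3 + 10 * dP * α₀ * α₂ →
          nB ≤ 2 * dP * LP * α₁ + C₂ * α₂ ^ 2 →
          36 * dP * (KL * ((B₀ * Amaj + 1) * (1 + 2 * b₁))) * α₂ ≤ 1 / 2 → 50 * dP * α₂ ≤ 1 →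
          2 * α₂ ^ 2 + 20 * dP * α₀ * α₂ + 2 * C₂ * α₂ ^ 2 ≤ α₀ + α₁ →
          msup (ℓ + 1) k |cf|⁻¹ (-1) (fun j (b : PBond (PV d ℓ m K hd hL) 0) => j ≤ (blkV1 hN D b).1.1) (WithLp.ofLp A) ≤
              5 * dP * LP * (KL * ((B₀ * Amaj + 1) * (1 + 2 * b₁))) * (α₀ + α₁) ∧
            msup (ℓ + 1) k |cf|⁻¹ (-2) (fun j (p : Fin (d + 1) × PBond (PV d ℓ m K hd hL) 0) => j ≤ (blkV1 hN D p.2).1.1)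
                (fun p : Fin (d + 1) × PBond (PV d ℓ m K hd hL) 0 => Dop p.1 (WithLp.ofLp A) p.2) ≤
              5 * dP * LP * (KL * ((B₀ * Amaj + 1) * (1 + 2 * b₁))) * (α₀ + α₁) ∧
            nJ ≤ 5 * dP * LP * (KL * ((B₀ * Amaj + 1) * (1 + 2 * b₁))) * (α₀ + α₁) ∧
            msup (ℓ + 1) k |cf|⁻¹ (-3) (fun j (b : PBond (PV d ℓ m K hd hL) 0) => j ≤ (blkV1 hN D b).1.1)
                (fun b : PBond (PV d ℓ m K hd hL) 0 => laplace cf (fun z => A ⟨z, b.dir⟩) b.src) ≤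
              5 * dP * LP * (KL * ((B₀ * Amaj + 1) * (1 + 2 * b₁))) * (α₀ + α₁) ∧
            (∀ b : PBond (PV d ℓ m K hd hL) 0,
              |WithLp.ofLp A b| ≤ 5 * dP * LP * (KL * ((B₀ * Amaj + 1) * (1 + 2 * b₁))) * (α₀ + α₁) *
                (((geomT D).len (blkV1 hN D b) * |cf|⁻¹) ^ 1)⁻¹) ∧
            (∀ (ν : Fin (d + 1)) (b : PBond (PV d ℓ m K hd hL) 0),
              |Dop ν (WithLp.ofLp A) b| ≤ 5 * dP * LP * (KL * ((B₀ * Amaj + 1) * (1 + 2 * b₁))) * (α₀ + α₁) *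
                (((geomT D).len (blkV1 hN D b) * |cf|⁻¹) ^ 2)⁻¹) ∧
            (∀ b : PBond (PV d ℓ m K hd hL) 0,
              |laplace cf (fun z => A ⟨z, b.dir⟩) b.src| ≤ 5 * dP * LP * (KL * ((B₀ * Amaj + 1) * (1 + 2 * b₁))) * (α₀ + α₁) *
                (((geomT D).len (blkV1 hN D b) * |cf|⁻¹) ^ 3)⁻¹) := by
  -- r03 g22's LINE 3 of (2.92) for the genuine cube member (`B6Line3CubeV1.line3_cube`, p366020): its own rate `ρ₃`, constants `C_D, c_D`, threshold `M₃`
  obtain ⟨ρ₃, CD, cD, M₃, hρ₃, hCD, hcD, hl3⟩ := line3_cube d ℓ hd hL hb₀ hb₁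
  -- §6 at the rates `σ ≤ min σ₀ (ρ₃/2)`, fed with r03's `C_D, c_D`
  obtain ⟨σ₀, hσ₀, h6⟩ := prop3_multiLevelTorus_V1_P26_pad_M d ℓ hd hL hb₀ hb₁
  refine ⟨min σ₀ (ρ₃ / 2), lt_min hσ₀ (by positivity), fun σ hσ hσle α hα0 hα1 => ?_⟩
  have hσ₀' : σ ≤ σ₀ := hσle.trans (min_le_left _ _)
  have h2σ : 2 * σ ≤ ρ₃ := by
    have h := hσle.trans (min_le_right _ _)
    linarith
  obtain ⟨B₀, KL, hB₀, hKL, h6'⟩ := h6 σ hσ hσ₀' α hα0 hα1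
  obtain ⟨Amaj, M₄, hA, hM₄, h6''⟩ := h6' hCD hcD
  refine ⟨B₀, KL, hB₀, hKL, Amaj, max M₄ M₃, hA, lt_max_of_lt_left hM₄, ?_⟩
  intro m K Mh k R P' hN D hk hk1 a hMha hM8 hR2 hP hℓ4 hM4t cf hcf w hw hwb Dop hD
  have hM4 : M₄ ≤ ((ℓ : ℝ) + 1) * Mh := (le_max_left _ _).trans hM4t
  have hM3 : M₃ ≤ ((ℓ : ℝ) + 1) * Mh := (le_max_right _ _).trans hM4t
  refine h6'' m K hN D hk hk1 hMha hM8 hR2 hP hℓ4 hM4 hcf hw hwb (fun c => ?_) Dop hD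
  -- line 3 on the cube `c` of `padT D` (a `(k+1)`-level family, every cube placed — p38's `placed_pad`), rate weakened `ρ₃ → 2σ`
  have hk2 : 2 ≤ k + 1 := by omega
  have h3 := hl3 m K (hN_pad hN (hLP_of_V1 hN hMha hP)) (padT D (hLP_of_V1 hN hMha hP)) (hk'_of_V1 hN hMha hP) hk2 hMha hM8 hR2
    (hP5_of_V1 hP) hℓ4 (placed_pad D (hLP_of_V1 hN hMha hP) (hP5_of_V1 hP)) hM3 hcf
    (w ∘ (sameOm_domT_pad hN D hk (hLP_of_V1 hN hMha hP) (hk'_of_V1 hN hMha hP)).idxB) c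
  refine hasMajorant_mono _ h3 fun y y'' => ?_
  have hP1 : ∀ μ, 1 ≤ P' μ / (ℓ + 1) := fun μ => le_trans (by norm_num) (hP5_of_V1 hP μ)
  have hd0 : 0 ≤ (geomTB (padT D (hLP_of_V1 hN hMha hP))).dist y y'' :=
    dist_nonneg_TB (padT D (hLP_of_V1 hN hMha hP)) (one_le_of_eight_le hM8) hP1 y y''
  have h0 : 0 ≤ CD * cf ^ 2 * Real.exp (-(cD * (geomTB (padT D (hLP_of_V1 hN hMha hP))).M)) /
      (geomTB (padT D (hLP_of_V1 hN hMha hP))).len y ^ 2 := by positivity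
  exact mul_le_mul_of_nonneg_left (Real.exp_le_exp.mpr (by nlinarith)) h0


/-! ## §8  (v1.5) SLOT 2 DISCHARGED TOO — p38 g30's `B6Prop26GradKLevelV1.prop26_2136_grad_kLevel_unconditional_pad_V1` feeds BOTH slots: Proposition 3 at `U₀ = 1` (vector side) modulo the B8-side hypotheses ONLY -/

open Classical in
/-- **[B8] PROPOSITION 3 AT `U₀ = 1` ON THE `k`-LEVEL V1 TORUS — EVERY ODD `L ≥ 5`, `k ≥ 1`, `P′ ≥ 5L`, NO [B6]-SIDE HYPOTHESIS** (v1.5): §7 `_free` with its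
slot-2 hypothesis discharged — both (2.136)₁ (for `G(1)`) and (2.136)₂ (for `∇_νG(1)`, `∇_ν = DV ν c′ = c′·(S_ν − 1)`) are p38 g30's
`B6Prop26GradKLevelV1.prop26_2136_grad_kLevel_unconditional_pad_V1` for the genuine `G` of `D` (one constant `A`, rate `delta3 α (2σ)`, `σ ∈ (0, σ₀]`), fed to
`B8Prop3MultiLevelTorusLap.prop3_multiLevelTorus_V1_pref_vecLap`; hypotheses left: the V1 torus data, ONE size threshold `M₄ ≤ L·M_h`, `c′ ≠ 0`, the weight band,
and the B8-side hypotheses (1.55)/(1.42)/(1.56) + size lines exactly as in the Lap file; conclusions: the seven of Prop. 3 / (1.59) with `B₀′ = K_L(B₀A + 1)(1 + 2b₁)`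
and `∇ = DV · c′`.  (p. 87, verbatim: *"then U₁ satisfies (1.36)–(1.39) with B₁ = 5dLB₀, B₂(β₀) = 5dLB₀(β₀), where B₀, B₀(β₀) are the corresponding norms of the
operators G(U₀), H(U₀), and depend on d and L only"*.)
[cite: Balaban1985RegularSpaces, Prop. 3 p.87, (1.59)–(1.62) pp.86–87, (1.55)–(1.58) p.86, (1.42) p.84; Balaban1984PropagatorsII, Prop. 2.6 (2.136) p.247, (2.92) p.239, Lemma 2.1 p.234; Balaban1984PropagatorsI, (1.4) p.18] -/
theorem prop3_multiLevelTorus_V1_P26_vector (d ℓ : ℕ) (hd : 1 ≤ d + 1) (hL : Odd (ℓ + 1) ∧ 1 < ℓ + 1) {b₀ b₁ : ℝ} (hb₀ : 0 < b₀) (hb₁ : b₀ ≤ b₁) :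
    ∃ σ₀ : ℝ, 0 < σ₀ ∧ ∀ (σ : ℝ), 0 < σ → σ ≤ σ₀ → ∀ (α : ℝ), 0 < α → α < 1 →
    ∃ B₀ KL : ℝ, 1 ≤ B₀ ∧ 1 ≤ KL ∧
    ∃ Amaj M₄ : ℝ, 0 ≤ Amaj ∧ 0 < M₄ ∧
    ∀ (m K : ℕ) {Mh k R : ℕ} {P' : Fin (d + 1) → ℕ}
      (hN : ∀ μ, N0 ℓ Mh k P' μ = (PV d ℓ m K hd hL).sitesPerDir 0) (D : TDomains d ℓ Mh k P' R) (hk : k ≤ m + K) (_ : 1 ≤ k)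
      {a : ℕ} (hMha : Mh = (ℓ + 1) ^ a) (hM8 : 8 ≤ Mh) (_ : 2 * (ℓ + 1) ^ 2 ≤ R) (hP : ∀ μ, 5 * (ℓ + 1) ≤ P' μ) (_ : 4 ≤ ℓ)
      -- ONE size threshold (p38 g30's `M₂` of `prop26_2136_grad_kLevel_unconditional_pad_V1` with this lineage's `M₃`, `N₁ + 1` folded in)
      (_ : M₄ ≤ ((ℓ : ℝ) + 1) * Mh)
      {cf : ℝ} (hcf : cf ≠ 0) {w : BondIdx (domT hN D hk) → ℝ} (hw : ∀ i, 0 < w i) (_ : GlobalBand b₀ b₁ cf w),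
      -- line 3 (iv): not a hypothesis (discharged inside p38 g30's producer by r03 g22's `B6Line3CubeV1.line3_cube` on `padT D`)
      -- slots 1 AND 2 ((2.136)₁ for `G(1)`, (2.136)₂ for `∇G(1)` with `∇_ν = DV ν c′`): NO LONGER HYPOTHESES (v1.5) — fed by p38 g30's
      -- `B6Prop26GradKLevelV1.prop26_2136_grad_kLevel_unconditional_pad_V1` (genuine `G` of `D`, every odd `L ≥ 5`, `k ≥ 1`, `P′ ≥ 5L`, no per-cube hypothesis)
      ∀ (A J : BondSpace (PV d ℓ m K hd hL)) (B : BondIdxSpace (domT hN D hk)),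
        dcsE cf (dcE cf A) = J → RE (domT hN D hk) cf (dsE cf A) = 0 → QE (domT hN D hk) A = B →
        ∀ (nJ nB : ℝ), 0 ≤ nJ → 0 ≤ nB →
          (∀ b, |J b| ≤ nJ * (((geomT D).len (blkV1 hN D b) * |cf|⁻¹) ^ 3)⁻¹) →
          (∀ i, |B i| ≤ nB * (((ℓ : ℝ) + 1) ^ (i.1.1 : ℕ) * |cf|⁻¹)⁻¹) →
        ∀ (dP LP C₂ α₀ α₁ α₂ : ℝ), 0 ≤ dP → 1 ≤ dP * LP → 0 ≤ α₀ → 0 ≤ α₁ → 0 ≤ α₂ →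
          nJ ≤ 2 * α₀ + 36 * dP * α₂ *
              msup (ℓ + 1) k |cf|⁻¹ (-2) (fun j (p : Fin (d + 1) × PBond (PV d ℓ m K hd hL) 0) => j ≤ (blkV1 hN D p.2).1.1)
                (fun p : Fin (d + 1) × PBond (PV d ℓ m K hd hL) 0 => DV (P := PV d ℓ m K hd hL) p.1 cf (WithLp.ofLp A) p.2) +
            50 * dP * α₂ ^ 3 + 10 * dP * α₀ * α₂ →
          nB ≤ 2 * dP * LP * α₁ + C₂ * α₂ ^ 2 →
          36 * dP * (KL * ((B₀ * Amaj + 1) * (1 + 2 * b₁))) * α₂ ≤ 1 / 2 → 50 * dP * α₂ ≤ 1 →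
          2 * α₂ ^ 2 + 20 * dP * α₀ * α₂ + 2 * C₂ * α₂ ^ 2 ≤ α₀ + α₁ →
          msup (ℓ + 1) k |cf|⁻¹ (-1) (fun j (b : PBond (PV d ℓ m K hd hL) 0) => j ≤ (blkV1 hN D b).1.1) (WithLp.ofLp A) ≤
              5 * dP * LP * (KL * ((B₀ * Amaj + 1) * (1 + 2 * b₁))) * (α₀ + α₁) ∧
            msup (ℓ + 1) k |cf|⁻¹ (-2) (fun j (p : Fin (d + 1) × PBond (PV d ℓ m K hd hL) 0) => j ≤ (blkV1 hN D p.2).1.1)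
                (fun p : Fin (d + 1) × PBond (PV d ℓ m K hd hL) 0 => DV (P := PV d ℓ m K hd hL) p.1 cf (WithLp.ofLp A) p.2) ≤
              5 * dP * LP * (KL * ((B₀ * Amaj + 1) * (1 + 2 * b₁))) * (α₀ + α₁) ∧
            nJ ≤ 5 * dP * LP * (KL * ((B₀ * Amaj + 1) * (1 + 2 * b₁))) * (α₀ + α₁) ∧
            msup (ℓ + 1) k |cf|⁻¹ (-3) (fun j (b : PBond (PV d ℓ m K hd hL) 0) => j ≤ (blkV1 hN D b).1.1)
                (fun b : PBond (PV d ℓ m K hd hL) 0 => laplace cf (fun z => A ⟨z, b.dir⟩) b.src) ≤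
              5 * dP * LP * (KL * ((B₀ * Amaj + 1) * (1 + 2 * b₁))) * (α₀ + α₁) ∧
            (∀ b : PBond (PV d ℓ m K hd hL) 0,
              |WithLp.ofLp A b| ≤ 5 * dP * LP * (KL * ((B₀ * Amaj + 1) * (1 + 2 * b₁))) * (α₀ + α₁) *
                (((geomT D).len (blkV1 hN D b) * |cf|⁻¹) ^ 1)⁻¹) ∧
            (∀ (ν : Fin (d + 1)) (b : PBond (PV d ℓ m K hd hL) 0),
              |DV (P := PV d ℓ m K hd hL) ν cf (WithLp.ofLp A) b| ≤ 5 * dP * LP * (KL * ((B₀ * Amaj + 1) * (1 + 2 * b₁))) * (α₀ + α₁) *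
                (((geomT D).len (blkV1 hN D b) * |cf|⁻¹) ^ 2)⁻¹) ∧
            (∀ b : PBond (PV d ℓ m K hd hL) 0,
              |laplace cf (fun z => A ⟨z, b.dir⟩) b.src| ≤ 5 * dP * LP * (KL * ((B₀ * Amaj + 1) * (1 + 2 * b₁))) * (α₀ + α₁) *
                (((geomT D).len (blkV1 hN D b) * |cf|⁻¹) ^ 3)⁻¹) := by
  -- p38 g30's admissible range of rates `(0, σ₁]` for the band `[b₀, b₁]` ((2.136)₁ ∧ (2.136)₂, line 3 and the Lemma-2.1 budget already inside)
  obtain ⟨σ₀, hσ₀, h26⟩ := prop26_2136_grad_kLevel_unconditional_pad_V1 d ℓ hd hL hb₀ hb₁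
  refine ⟨σ₀, hσ₀, fun σ hσ hσle α hα0 hα1 => ?_⟩
  -- the decay rate of the delivered majorants and this lineage's constants at that rate
  have hσ' : 0 < delta3 α (2 * σ) := delta3_pos hα1 (by positivity)
  obtain ⟨B₀, KL, M₃, N₁, hB₀, hKL, hM₃, hN₁, hS⟩ := prop3_multiLevelTorus_V1_pref_vecLap d ℓ hd hL hσ'
  refine ⟨B₀, KL, hB₀, hKL, ?_⟩
  -- p38's constants `A, M₂` (ONE constant for both slots); ONE threshold `M₄ := max M₂ (max M₃ (N₁ + 1))`
  obtain ⟨Amaj, M₂, hA, hM₂, hG26⟩ := h26 σ hσ hσle α hα0 hα1.le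
  refine ⟨Amaj, max M₂ (max M₃ ((N₁ : ℝ) + 1)), hA, lt_max_of_lt_left hM₂, ?_⟩
  intro m K Mh k R P' hN D hk hk1 a hMha hM8 hR2 hP hℓ4 hM4t cf hcf w hw hwb
    A J B h55 h42 h56 nJ nB hnJ hnB hJ hB dP LP C₂ α₀ α₁ α₂ hdP hdL hα₀ hα₁ hα₂ h55s h56s hside h50 h61
  -- the single threshold implies the three it replaces
  have hM2t : M₂ ≤ ((ℓ : ℝ) + 1) * Mh := le_trans (le_max_left _ _) hM4t
  have hM3t : M₃ ≤ ((ℓ : ℝ) + 1) * Mh := le_trans ((le_max_left _ _).trans (le_max_right _ _)) hM4t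
  have hN1r : (N₁ : ℝ) + 1 ≤ ((ℓ : ℝ) + 1) * Mh := le_trans ((le_max_right _ _).trans (le_max_right _ _)) hM4t
  have hN1t : N₁ + 1 ≤ R * ((ℓ + 1) * Mh) := by
    have h1 : N₁ + 1 ≤ (ℓ + 1) * Mh := by exact_mod_cast hN1r
    have hR1 : 1 ≤ R := le_trans (Nat.one_le_iff_ne_zero.mpr (by positivity)) hR2
    calc N₁ + 1 ≤ (ℓ + 1) * Mh := h1
      _ = 1 * ((ℓ + 1) * Mh) := (one_mul _).symm
      _ ≤ R * ((ℓ + 1) * Mh) := Nat.mul_le_mul_right _ hR1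
  -- slot 1 AND slot 2 = p38's conclusion for the genuine `G` of `D` at the rate `2σ`, literally (`Dop ν := DV ν c′`)
  obtain ⟨hG, hD⟩ := hG26 m K hN D hk hk1 hMha hM8 hR2 hP hℓ4 hM2t hcf hw hwb
  -- the producer's thresholds imply this lineage's
  have hMh1 : 1 ≤ Mh := le_trans (by norm_num) hM8
  have hR2' : 2 * (ℓ + 1) ≤ R := by
    have h1 : ℓ + 1 ≤ (ℓ + 1) ^ 2 := by nlinarith
    exact le_trans (Nat.mul_le_mul_left 2 h1) hR2
  have hP4 : ∀ μ, 4 ≤ P' μ := fun μ => le_trans (by omega) (hP μ)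
  exact hS k Mh R hMh1 hN1t hR2' hM3t P' hP4 D m K hN hk cf hcf w hw b₀ b₁ hb₀.le (hb₀.le.trans hb₁) hwb Amaj hA
    (fun ν => DV (P := PV d ℓ m K hd hL) ν cf) hG hD
    A J B h55 h42 h56 nJ nB hnJ hnB hJ hB dP LP C₂ α₀ α₁ α₂ hdP hdL hα₀ hα₁ hα₂ h55s h56s hside h50 h61


/-! ## §9  (v1.6) THE FIRST B8-SIDE HYPOTHESIS DISCHARGED: (1.55) DERIVED for the abelian group `U(1)` from (1.40)/(1.41) — Proposition 3 at `U₀ = 1` for `U(1)` fields `U₁ = e^{iηA}` -/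

open B8Eq155AbelianMultiLevelTorus (adU1 entryU1 expCfg ineq155_abelian_kLevel) in
open LatticeFieldCalculus (covDivPlaq) in
open GaugeField (plaqHol) in
open Classical in
/-- **[B8] PROPOSITION 3 AT `U₀ = 1` ON THE `k`-LEVEL V1 TORUS FOR `U(1)` FIELDS `U₁ = e^{iηA}` — FROM THE PRINTED HYPOTHESES (1.40), (1.41), (1.42)** (v1.6):
§8 `_vector` with its (1.55) size-line hypothesis («D^{η*}_{U₀}D^η_{U₀}A = J, |J|₍₋₃₎ ≦ 2α₀ + 36dα₂|∇^η_{U₀}A|₍₋₂₎ + 50dα₂³ + 10dα₀α₂», p. 86) NO LONGER ASSUMED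
but DERIVED, for the abelian gauge group `U(1)` (the Lie algebra `iℝ` ≅ the real scalar fibre of this whole lane; `U₁(b) = e^{iηA(b)}`, `A` a real bond function,
`η = |c′|⁻¹`), from (1.40) in its (1.9) member for `U₁` — *"|(D^{η*}_U ∂U)(b)| < α₀L^{−2j}(Lʲη)⁻¹ for b ∈ Ω_j"* (p. 77), the quantity of p40's typed
`B8Eq17ClassAkV1.BondClause19` with `R(U)X = UXU⁻¹ ≡ X` on `M₁(ℂ) = ℂ` and `ι : U(1) ⊂ ℂ` (`B8Eq155AbelianMultiLevelTorus.adU1`/`entryU1`/`expCfg`; the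
`U₀ = 1` half of (1.40) holds with `0`) — and (1.41) *"U₁ = e^{iηA}, |A| < α₂(Lʲη)⁻¹ on Ω_j"* (p. 83), by `B8Eq155AbelianMultiLevelTorus.ineq155_abelian_kLevel`
(pp. 84–86 (1.47)–(1.55) for `U(1)` at `U₀ = 1`: `U₁(∂p) = e^{iη²(D^ηA)(p)}`, `V₂ = η²(D^ηA)²` real, `D^{η*}_{U₁} = ∂*`; sharper abelian constant
`n_J = α₀ + (128/5)dL³α₂³ ≦ 2α₀ + 36d_Pα₂|∇A|₍₋₂₎ + 50d_Pα₂³ + 10d_Pα₀α₂` for `d_P ≥ d·L³`, the located `L³` of the one-layer-wider reading of «on Ω_j»,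
GAPS G-B8-16, in the `blkV1` level encoding).  REMAINING HYPOTHESES: the V1 torus data and ONE size threshold as in §8; (1.42) — the Landau condition
`R∂*A = 0` and the LINEAR average `QA = B` with the (1.56) size line «|B₁| < 2dLα₁ + C₂α₂²» (print derives it from the non-linear average `Q_j(U₀, ηA) = B`,
`|B| < 2dLα₁`, by [3] Prop. 4 — proved on the ℤᵈ carriers, `B8Eq156Prop4`, not modelled on the torus); the smallness «B₀′36dα₂ ≦ ½», «50dα₂ ≦ 1»,
`4Lα₂ ≤ 1`; and (1.61).  CONCLUSIONS: the seven of §8 with `J := ∂*∂A` — (1.62)/(1.36)/(1.39) at `U₀ = 1`: `|A|₍₋₁₎, |∇A|₍₋₂₎, |Δ^ηA|₍₋₃₎ ≦ B₁(α₀+α₁)` in print's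
norms and `|A|, |∇_νA|, |D^{η*}D^ηA|, |Δ^ηA| ≦ B₁(α₀+α₁)(Lʲη)^{−1,−2,−3,−3}` «on Ω_j», `B₁ = 5d_PL_P·K_L(B₀A + 1)(1 + 2b₁)`.  (p. 87, verbatim: *"If U₀, U₁U₀
satisfy (1.40)–(1.42) with α₀, α₁, α₂ bounded by a constant depending on d and L only, and α₂ satisfies the additional restriction (1.61), then U₁ satisfies
(1.36)–(1.39) with B₁ = 5dLB₀"*.)  Pure plumbing: §8 ∘ `ineq155_abelian_kLevel`.
[cite: Balaban1985RegularSpaces, Prop. 3 p.87, (1.40)–(1.42) p.83, (1.9) p.77, (1.55) p.86, (1.59)–(1.62) pp.86–87; Balaban1984PropagatorsII, Prop. 2.6 (2.136) p.247] -/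
theorem prop3_multiLevelTorus_V1_P26_U1 (d ℓ : ℕ) (hd : 1 ≤ d + 1) (hL : Odd (ℓ + 1) ∧ 1 < ℓ + 1) {b₀ b₁ : ℝ} (hb₀ : 0 < b₀) (hb₁ : b₀ ≤ b₁) :
    ∃ σ₀ : ℝ, 0 < σ₀ ∧ ∀ (σ : ℝ), 0 < σ → σ ≤ σ₀ → ∀ (α : ℝ), 0 < α → α < 1 →
    ∃ B₀ KL : ℝ, 1 ≤ B₀ ∧ 1 ≤ KL ∧
    ∃ Amaj M₄ : ℝ, 0 ≤ Amaj ∧ 0 < M₄ ∧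
    ∀ (m K : ℕ) {Mh k R : ℕ} {P' : Fin (d + 1) → ℕ}
      (hN : ∀ μ, N0 ℓ Mh k P' μ = (PV d ℓ m K hd hL).sitesPerDir 0) (D : TDomains d ℓ Mh k P' R) (hk : k ≤ m + K) (_ : 1 ≤ k)
      {a : ℕ} (hMha : Mh = (ℓ + 1) ^ a) (hM8 : 8 ≤ Mh) (_ : 2 * (ℓ + 1) ^ 2 ≤ R) (hP : ∀ μ, 5 * (ℓ + 1) ≤ P' μ) (_ : 4 ≤ ℓ)
      -- ONE size threshold (p38 g30's `M₂` of `prop26_2136_grad_kLevel_unconditional_pad_V1` with this lineage's `M₃`, `N₁ + 1` folded in)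
      (_ : M₄ ≤ ((ℓ : ℝ) + 1) * Mh)
      {cf : ℝ} (hcf : cf ≠ 0) {w : BondIdx (domT hN D hk) → ℝ} (hw : ∀ i, 0 < w i) (_ : GlobalBand b₀ b₁ cf w),
      -- no [B6]-side hypothesis (§8: both (2.136) slots fed by p38 g30's `B6Prop26GradKLevelV1.prop26_2136_grad_kLevel_unconditional_pad_V1`)
      -- (1.41) «U₁ = e^{iηA}» for a REAL bond function `A` (gauge group `U(1)`, `η = |c′|⁻¹`); (1.42): Landau `R∂*A = 0`, linear average `QA = B`
      ∀ (A : BondSpace (PV d ℓ m K hd hL)) (B : BondIdxSpace (domT hN D hk)),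
        RE (domT hN D hk) cf (dsE cf A) = 0 → QE (domT hN D hk) A = B →
        ∀ (α₀ α₂ : ℝ), 0 ≤ α₀ → 0 ≤ α₂ → 4 * ((ℓ : ℝ) + 1) * α₂ ≤ 1 →
          -- (1.40): the (1.9) member «|(D^{η*}_{U₁}∂U₁)(b)| < α₀L^{−2j}(Lʲη)⁻¹» of `U₁ = e^{iηA} ∈ 𝔄_k({Ω_j}, α₀)` (p40's `BondClause19` quantity with
          -- `R = Ad ≡ id`, `ι : U(1) ⊂ ℂ`; `U₀ = 1` satisfies it with `0`) — v1.6: REPLACES the (1.55) size line of §8, now DERIVED (`B8Eq155AbelianMultiLevelTorus`)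
          (∀ b : PBond (PV d ℓ m K hd hL) 0,
            ‖covDivPlaq adU1 |cf| (expCfg |cf|⁻¹ (WithLp.ofLp A)) (fun p => entryU1 (plaqHol (expCfg |cf|⁻¹ (WithLp.ofLp A)) p)) b‖
              ≤ α₀ * (((geomT D).len (blkV1 hN D b)) ^ 2)⁻¹ * ((geomT D).len (blkV1 hN D b) * |cf|⁻¹)⁻¹) →
          -- (1.41) «|A| < α₂(Lʲη)⁻¹ on Ω_j»
          (∀ b : PBond (PV d ℓ m K hd hL) 0, |WithLp.ofLp A b| ≤ α₂ * ((geomT D).len (blkV1 hN D b) * |cf|⁻¹)⁻¹) →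
        ∀ (nB : ℝ), 0 ≤ nB → (∀ i, |B i| ≤ nB * (((ℓ : ℝ) + 1) ^ (i.1.1 : ℕ) * |cf|⁻¹)⁻¹) →
        -- print's letters `d`, `L` as reals `d_P ≥ d·L³` (the located `L³` of G-B8-16), `L_P` with `d_PL_P ≥ 1`; (1.56) size line; smallness; (1.61)
        ∀ (dP LP C₂ α₁ : ℝ), (d : ℝ) * ((ℓ : ℝ) + 1) ^ 3 ≤ dP → 1 ≤ dP * LP → 0 ≤ α₁ →
          nB ≤ 2 * dP * LP * α₁ + C₂ * α₂ ^ 2 →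
          36 * dP * (KL * ((B₀ * Amaj + 1) * (1 + 2 * b₁))) * α₂ ≤ 1 / 2 → 50 * dP * α₂ ≤ 1 →
          2 * α₂ ^ 2 + 20 * dP * α₀ * α₂ + 2 * C₂ * α₂ ^ 2 ≤ α₀ + α₁ →
          msup (ℓ + 1) k |cf|⁻¹ (-1) (fun j (b : PBond (PV d ℓ m K hd hL) 0) => j ≤ (blkV1 hN D b).1.1) (WithLp.ofLp A) ≤
              5 * dP * LP * (KL * ((B₀ * Amaj + 1) * (1 + 2 * b₁))) * (α₀ + α₁) ∧
            msup (ℓ + 1) k |cf|⁻¹ (-2) (fun j (p : Fin (d + 1) × PBond (PV d ℓ m K hd hL) 0) => j ≤ (blkV1 hN D p.2).1.1)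
                (fun p : Fin (d + 1) × PBond (PV d ℓ m K hd hL) 0 => DV (P := PV d ℓ m K hd hL) p.1 cf (WithLp.ofLp A) p.2) ≤
              5 * dP * LP * (KL * ((B₀ * Amaj + 1) * (1 + 2 * b₁))) * (α₀ + α₁) ∧
            (∀ b : PBond (PV d ℓ m K hd hL) 0,
              |dcsE cf (dcE cf A) b| ≤ 5 * dP * LP * (KL * ((B₀ * Amaj + 1) * (1 + 2 * b₁))) * (α₀ + α₁) *
                (((geomT D).len (blkV1 hN D b) * |cf|⁻¹) ^ 3)⁻¹) ∧
            msup (ℓ + 1) k |cf|⁻¹ (-3) (fun j (b : PBond (PV d ℓ m K hd hL) 0) => j ≤ (blkV1 hN D b).1.1)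
                (fun b : PBond (PV d ℓ m K hd hL) 0 => laplace cf (fun z => A ⟨z, b.dir⟩) b.src) ≤
              5 * dP * LP * (KL * ((B₀ * Amaj + 1) * (1 + 2 * b₁))) * (α₀ + α₁) ∧
            (∀ b : PBond (PV d ℓ m K hd hL) 0,
              |WithLp.ofLp A b| ≤ 5 * dP * LP * (KL * ((B₀ * Amaj + 1) * (1 + 2 * b₁))) * (α₀ + α₁) *
                (((geomT D).len (blkV1 hN D b) * |cf|⁻¹) ^ 1)⁻¹) ∧
            (∀ (ν : Fin (d + 1)) (b : PBond (PV d ℓ m K hd hL) 0),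
              |DV (P := PV d ℓ m K hd hL) ν cf (WithLp.ofLp A) b| ≤ 5 * dP * LP * (KL * ((B₀ * Amaj + 1) * (1 + 2 * b₁))) * (α₀ + α₁) *
                (((geomT D).len (blkV1 hN D b) * |cf|⁻¹) ^ 2)⁻¹) ∧
            (∀ b : PBond (PV d ℓ m K hd hL) 0,
              |laplace cf (fun z => A ⟨z, b.dir⟩) b.src| ≤ 5 * dP * LP * (KL * ((B₀ * Amaj + 1) * (1 + 2 * b₁))) * (α₀ + α₁) *
                (((geomT D).len (blkV1 hN D b) * |cf|⁻¹) ^ 3)⁻¹) := by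
  obtain ⟨σ₀, hσ₀, hV⟩ := prop3_multiLevelTorus_V1_P26_vector d ℓ hd hL hb₀ hb₁
  refine ⟨σ₀, hσ₀, fun σ hσ hσle α hα0 hα1 => ?_⟩
  obtain ⟨B₀, KL, hB₀, hKL, Amaj, M₄, hA, hM₄, hV'⟩ := hV σ hσ hσle α hα0 hα1
  refine ⟨B₀, KL, hB₀, hKL, Amaj, M₄, hA, hM₄, ?_⟩
  intro m K Mh k R P' hN D hk hk1 a hMha hM8 hR2 hP hℓ4 hM4t cf hcf w hw hwb A B h42 h56 α₀ α₂ hα₀ hα₂ hsmall h40 h41 nB hnB hB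
    dP LP C₂ α₁ hdP hdL hα₁ h56s hside h50 h61
  -- the regime: `R ≥ 2L² ≥ 1`, `M_h ≥ 8 ≥ 1`, `d_P ≥ d·L³ ≥ 0`
  have hR1 : 1 ≤ R := le_trans (Nat.one_le_iff_ne_zero.mpr (by positivity)) hR2
  have hMh1 : 1 ≤ Mh := le_trans (by norm_num) hM8
  have hdP0 : 0 ≤ dP := le_trans (by positivity) hdP
  -- (1.55) DERIVED for `U(1)` at `U₀ = 1` (`B8Eq155AbelianMultiLevelTorus.ineq155_abelian_kLevel`), in the sharper abelian form `nJ = α₀ + (128/5)dL³α₂³`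
  set nJ : ℝ := α₀ + 128 / 5 * d * ((ℓ : ℝ) + 1) ^ 3 * α₂ ^ 3 with hnJdef
  have hnJ : 0 ≤ nJ := by positivity
  have hJ : ∀ b, |dcsE cf (dcE cf A) b| ≤ nJ * (((geomT D).len (blkV1 hN D b) * |cf|⁻¹) ^ 3)⁻¹ := fun b =>
    ineq155_abelian_kLevel hN D hR1 hMh1 hcf hα₂ hsmall A h40 h41 b
  -- hence print's (1.55) size line «n_J ≦ 2α₀ + 36dα₂|∇A|₍₋₂₎ + 50dα₂³ + 10dα₀α₂» for every value of |∇A|₍₋₂₎ ≥ 0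
  have hX : 0 ≤ msup (ℓ + 1) k |cf|⁻¹ (-2) (fun j (p : Fin (d + 1) × PBond (PV d ℓ m K hd hL) 0) => j ≤ (blkV1 hN D p.2).1.1)
      (fun p : Fin (d + 1) × PBond (PV d ℓ m K hd hL) 0 => DV (P := PV d ℓ m K hd hL) p.1 cf (WithLp.ofLp A) p.2) :=
    B8ScaledSupNorm.msup_nonneg _ _ (inv_nonneg.mpr (abs_nonneg cf)) _ _ _
  have h55s : nJ ≤ 2 * α₀ + 36 * dP * α₂ *
      msup (ℓ + 1) k |cf|⁻¹ (-2) (fun j (p : Fin (d + 1) × PBond (PV d ℓ m K hd hL) 0) => j ≤ (blkV1 hN D p.2).1.1)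
        (fun p : Fin (d + 1) × PBond (PV d ℓ m K hd hL) 0 => DV (P := PV d ℓ m K hd hL) p.1 cf (WithLp.ofLp A) p.2) +
      50 * dP * α₂ ^ 3 + 10 * dP * α₀ * α₂ := by
    have hd0 : (0 : ℝ) ≤ d := Nat.cast_nonneg d
    rw [hnJdef]
    nlinarith [mul_nonneg hdP0 (mul_nonneg hα₂ hX), mul_nonneg hdP0 (mul_nonneg hα₀ hα₂), pow_nonneg hα₂ 3,
      mul_le_mul_of_nonneg_right hdP (pow_nonneg hα₂ 3)]
  obtain ⟨c1, c2, c3, c4, c5, c6, c7⟩ := hV' m K hN D hk hk1 hMha hM8 hR2 hP hℓ4 hM4t hcf hw hwb A (dcsE cf (dcE cf A)) B rfl h42 h56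
    nJ nB hnJ hnB hJ hB dP LP C₂ α₀ α₁ α₂ hdP0 hdL hα₀ hα₁ hα₂ h55s h56s hside h50 h61
  refine ⟨c1, c2, fun b => (hJ b).trans (mul_le_mul_of_nonneg_right c3 ?_), c4, c5, c6, c7⟩
  rw [B8Ineq159MultiLevelTorus.len_blkV1]
  positivity


/-! ## §10  (v1.7) HYPOTHESIS (1.40) VERBATIM: `U₁ = e^{iηA} ∈ 𝔄_k({Ω_j}, α₀)` in p40's typed class `B8Eq17ClassAkV1.ClassAk` -/

open B8Eq155AbelianMultiLevelTorus (adU1 entryU1 expCfg h40_of_bondClause19) in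
open LatticeFieldCalculus (covDivPlaq) in
open GaugeField (plaqHol) in
open Classical in
/-- **[B8] PROPOSITION 3 AT `U₀ = 1` ON THE `k`-LEVEL V1 TORUS FOR `U(1)` FIELDS, HYPOTHESIS (1.40) IN ITS PRINTED FORM** (v1.7): §9 `_U1` with its
pointwise (1.9)-input replaced by the literal class membership of (1.40) p. 83 — *"U₀, U₁U₀ ∈ 𝔄_k({Ω_j}, α₀)"* — at `U₀ = 1`, i.e. `U₁ = e^{iηA} ∈ 𝔄_k({Ω_j}, α₀)`
in p40's typed class `B8Eq17ClassAkV1.ClassAk R ι Ω k η L α₀ U` = (1.7) *"|U(∂p) − 1| < α₀L^{−2j} for p ∈ Ω_j"* ∧ (1.9) *"|(D^{η*}_U ∂U)(b)| < α₀L^{−2j}(Lʲη)⁻¹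
for b ∈ Ω_j, j = 0, 1, …, k"* (p. 77), with `R(U)X = UXU⁻¹ ≡ X` on `M₁(ℂ) = ℂ` (`adU1`), `ι : U(1) ⊂ ℂ` (`entryU1`), `η = |c′|⁻¹`, `L = ℓ + 1`, and the site
domains `Ω_l := {x : l ≤ j(x)}` of the torus family `D` (`j(x) = D.lev (toBox x)`; the bonds and plaquettes of `Ω_l` by the p. 77 convention
`B15DeterminingSets.bondsOf` / `B8Eq17ClassAkV1.plaqsOf` — a bond belongs to `Ω_l` as soon as ONE endpoint does, so the class restricted to the initial points,
`B8Eq17ClassAkV1.bondClause19_anti_set`, is the `h40` of §9 via `B8Eq155AbelianMultiLevelTorus.h40_of_bondClause19`; the plaquette clause (1.7) is carried and NOT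
used by the proof — it is a genuine extra assumption here exactly as in print, NOT a consequence of (1.41), which only gives print՚s p. 84 size `|U₁(∂p) − 1| = O(α₂(Lʲη)⁻¹η)`,
`B8Eq155AbelianMultiLevelTorus.norm_entryU1_plaqHol_sub_one_le`, p. 84).  The `U₀`-half of (1.40) holds at
`U₀ = 1` (`B8Eq17ClassAkV1.classAk_one`) and «U₀ satisfies (3.35) in [4]» is void for the flat background.  Everything else — (1.41), (1.42), the (1.56) size
line, the smallness and (1.61), and the seven conclusions — exactly as in §9.  Pure plumbing: §9 ∘ `bondClause19_anti_set` ∘ `h40_of_bondClause19`.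
[cite: Balaban1985RegularSpaces, Prop. 3 p.87, (1.40)–(1.42) p.83, (1.7)–(1.9) p.77, (1.55) p.86; Balaban1984PropagatorsII, Prop. 2.6 (2.136) p.247] -/
theorem prop3_multiLevelTorus_V1_P26_U1_classAk (d ℓ : ℕ) (hd : 1 ≤ d + 1) (hL : Odd (ℓ + 1) ∧ 1 < ℓ + 1) {b₀ b₁ : ℝ} (hb₀ : 0 < b₀) (hb₁ : b₀ ≤ b₁) :
    ∃ σ₀ : ℝ, 0 < σ₀ ∧ ∀ (σ : ℝ), 0 < σ → σ ≤ σ₀ → ∀ (α : ℝ), 0 < α → α < 1 →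
    ∃ B₀ KL : ℝ, 1 ≤ B₀ ∧ 1 ≤ KL ∧
    ∃ Amaj M₄ : ℝ, 0 ≤ Amaj ∧ 0 < M₄ ∧
    ∀ (m K : ℕ) {Mh k R : ℕ} {P' : Fin (d + 1) → ℕ}
      (hN : ∀ μ, N0 ℓ Mh k P' μ = (PV d ℓ m K hd hL).sitesPerDir 0) (D : TDomains d ℓ Mh k P' R) (hk : k ≤ m + K) (_ : 1 ≤ k)
      {a : ℕ} (hMha : Mh = (ℓ + 1) ^ a) (hM8 : 8 ≤ Mh) (_ : 2 * (ℓ + 1) ^ 2 ≤ R) (hP : ∀ μ, 5 * (ℓ + 1) ≤ P' μ) (_ : 4 ≤ ℓ)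
      -- ONE size threshold (p38 g30's `M₂` of `prop26_2136_grad_kLevel_unconditional_pad_V1` with this lineage's `M₃`, `N₁ + 1` folded in)
      (_ : M₄ ≤ ((ℓ : ℝ) + 1) * Mh)
      {cf : ℝ} (hcf : cf ≠ 0) {w : BondIdx (domT hN D hk) → ℝ} (hw : ∀ i, 0 < w i) (_ : GlobalBand b₀ b₁ cf w),
      -- no [B6]-side hypothesis (§8: both (2.136) slots fed by p38 g30's `B6Prop26GradKLevelV1.prop26_2136_grad_kLevel_unconditional_pad_V1`)
      -- (1.41) «U₁ = e^{iηA}» for a REAL bond function `A` (gauge group `U(1)`, `η = |c′|⁻¹`); (1.42): Landau `R∂*A = 0`, linear average `QA = B`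
      ∀ (A : BondSpace (PV d ℓ m K hd hL)) (B : BondIdxSpace (domT hN D hk)),
        RE (domT hN D hk) cf (dsE cf A) = 0 → QE (domT hN D hk) A = B →
        ∀ (α₀ α₂ : ℝ), 0 ≤ α₀ → 0 ≤ α₂ → 4 * ((ℓ : ℝ) + 1) * α₂ ≤ 1 →
          -- (1.40) VERBATIM at `U₀ = 1`: «U₁U₀ ∈ 𝔄_k({Ω_j}, α₀)», i.e. `U₁ = e^{iηA} ∈ 𝔄_k({Ω_j}, α₀)` in p40's typed class (plaquette clause (1.7) ∧
          -- bond clause (1.9), `R = Ad ≡ id`, `ι : U(1) ⊂ ℂ`), `Ω_l` = the sites of level `≥ l` of the torus family (bonds/plaquettes of `Ω_l` by the p. 77 convention)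
          B8Eq17ClassAkV1.ClassAk adU1 entryU1
              (fun l => {x : Site (PV d ℓ m K hd hL) 0 | l ≤ D.lev (toBox hN x : Fin (d + 1) → ℤ)}) k |cf|⁻¹ (ℓ + 1) α₀
              (expCfg |cf|⁻¹ (WithLp.ofLp A)) →
          -- (1.41) «|A| < α₂(Lʲη)⁻¹ on Ω_j»
          (∀ b : PBond (PV d ℓ m K hd hL) 0, |WithLp.ofLp A b| ≤ α₂ * ((geomT D).len (blkV1 hN D b) * |cf|⁻¹)⁻¹) →
        ∀ (nB : ℝ), 0 ≤ nB → (∀ i, |B i| ≤ nB * (((ℓ : ℝ) + 1) ^ (i.1.1 : ℕ) * |cf|⁻¹)⁻¹) →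
        -- print's letters `d`, `L` as reals `d_P ≥ d·L³` (the located `L³` of G-B8-16), `L_P` with `d_PL_P ≥ 1`; (1.56) size line; smallness; (1.61)
        ∀ (dP LP C₂ α₁ : ℝ), (d : ℝ) * ((ℓ : ℝ) + 1) ^ 3 ≤ dP → 1 ≤ dP * LP → 0 ≤ α₁ →
          nB ≤ 2 * dP * LP * α₁ + C₂ * α₂ ^ 2 →
          36 * dP * (KL * ((B₀ * Amaj + 1) * (1 + 2 * b₁))) * α₂ ≤ 1 / 2 → 50 * dP * α₂ ≤ 1 →
          2 * α₂ ^ 2 + 20 * dP * α₀ * α₂ + 2 * C₂ * α₂ ^ 2 ≤ α₀ + α₁ →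
          msup (ℓ + 1) k |cf|⁻¹ (-1) (fun j (b : PBond (PV d ℓ m K hd hL) 0) => j ≤ (blkV1 hN D b).1.1) (WithLp.ofLp A) ≤
              5 * dP * LP * (KL * ((B₀ * Amaj + 1) * (1 + 2 * b₁))) * (α₀ + α₁) ∧
            msup (ℓ + 1) k |cf|⁻¹ (-2) (fun j (p : Fin (d + 1) × PBond (PV d ℓ m K hd hL) 0) => j ≤ (blkV1 hN D p.2).1.1)
                (fun p : Fin (d + 1) × PBond (PV d ℓ m K hd hL) 0 => DV (P := PV d ℓ m K hd hL) p.1 cf (WithLp.ofLp A) p.2) ≤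
              5 * dP * LP * (KL * ((B₀ * Amaj + 1) * (1 + 2 * b₁))) * (α₀ + α₁) ∧
            (∀ b : PBond (PV d ℓ m K hd hL) 0,
              |dcsE cf (dcE cf A) b| ≤ 5 * dP * LP * (KL * ((B₀ * Amaj + 1) * (1 + 2 * b₁))) * (α₀ + α₁) *
                (((geomT D).len (blkV1 hN D b) * |cf|⁻¹) ^ 3)⁻¹) ∧
            msup (ℓ + 1) k |cf|⁻¹ (-3) (fun j (b : PBond (PV d ℓ m K hd hL) 0) => j ≤ (blkV1 hN D b).1.1)
                (fun b : PBond (PV d ℓ m K hd hL) 0 => laplace cf (fun z => A ⟨z, b.dir⟩) b.src) ≤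
              5 * dP * LP * (KL * ((B₀ * Amaj + 1) * (1 + 2 * b₁))) * (α₀ + α₁) ∧
            (∀ b : PBond (PV d ℓ m K hd hL) 0,
              |WithLp.ofLp A b| ≤ 5 * dP * LP * (KL * ((B₀ * Amaj + 1) * (1 + 2 * b₁))) * (α₀ + α₁) *
                (((geomT D).len (blkV1 hN D b) * |cf|⁻¹) ^ 1)⁻¹) ∧
            (∀ (ν : Fin (d + 1)) (b : PBond (PV d ℓ m K hd hL) 0),
              |DV (P := PV d ℓ m K hd hL) ν cf (WithLp.ofLp A) b| ≤ 5 * dP * LP * (KL * ((B₀ * Amaj + 1) * (1 + 2 * b₁))) * (α₀ + α₁) *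
                (((geomT D).len (blkV1 hN D b) * |cf|⁻¹) ^ 2)⁻¹) ∧
            (∀ b : PBond (PV d ℓ m K hd hL) 0,
              |laplace cf (fun z => A ⟨z, b.dir⟩) b.src| ≤ 5 * dP * LP * (KL * ((B₀ * Amaj + 1) * (1 + 2 * b₁))) * (α₀ + α₁) *
                (((geomT D).len (blkV1 hN D b) * |cf|⁻¹) ^ 3)⁻¹) := by
  obtain ⟨σ₀, hσ₀, hV⟩ := prop3_multiLevelTorus_V1_P26_U1 d ℓ hd hL hb₀ hb₁
  refine ⟨σ₀, hσ₀, fun σ hσ hσle α hα0 hα1 => ?_⟩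
  obtain ⟨B₀, KL, hB₀, hKL, Amaj, M₄, hA, hM₄, hV'⟩ := hV σ hσ hσle α hα0 hα1
  refine ⟨B₀, KL, hB₀, hKL, Amaj, M₄, hA, hM₄, ?_⟩
  intro m K Mh k R P' hN D hk hk1 a hMha hM8 hR2 hP hℓ4 hM4t cf hcf w hw hwb A B h42 h56 α₀ α₂ hα₀ hα₂ hsmall hAk h41
  -- (1.40) ⊇ its bond clause (1.9) on the bonds whose INITIAL point lies in `Ω_l` (p. 77 convention: a bond of `Ω_l` has an endpoint in `Ω_l`)
  have h19 : B8Eq17ClassAkV1.BondClause19 adU1 entryU1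
      (fun l => {b : PBond (PV d ℓ m K hd hL) 0 | l ≤ D.lev (toBox hN b.src : Fin (d + 1) → ℤ)}) k |cf|⁻¹ (ℓ + 1) α₀
      (expCfg |cf|⁻¹ (WithLp.ofLp A)) :=
    B8Eq17ClassAkV1.bondClause19_anti_set (fun l b hb => Or.inl hb) hAk.2
  -- hence the pointwise (1.9) input of §9 (`η⁻¹ = |c′|`)
  have h40 : ∀ b : PBond (PV d ℓ m K hd hL) 0,
      ‖covDivPlaq adU1 |cf| (expCfg |cf|⁻¹ (WithLp.ofLp A)) (fun p => entryU1 (plaqHol (expCfg |cf|⁻¹ (WithLp.ofLp A)) p)) b‖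
        ≤ α₀ * (((geomT D).len (blkV1 hN D b)) ^ 2)⁻¹ * ((geomT D).len (blkV1 hN D b) * |cf|⁻¹)⁻¹ := by
    intro b
    have h := h40_of_bondClause19 hN D A h19 b
    rwa [inv_inv] at h
  exact hV' m K hN D hk hk1 hMha hM8 hR2 hP hℓ4 hM4t hcf hw hwb A B h42 h56 α₀ α₂ hα₀ hα₂ hsmall h40 h41

end

end Literature.MathematicalPhysics.QuantumFieldTheory.Balaban1983to89.B8Prop3MultiLevelTorusP26
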